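import Literature.Geometry.Kaehler.ComplexTorusNeronSeveriLieAlgebraIsogeny
import Literature.Geometry.Kaehler.ComplexTorusEndomorphismAlgebraProduct
import Literature.Geometry.Kaehler.ComplexTorusProduct
import Mathlib.Algebra.Lie.Prod
import HarnessLib

/-!
# Looijenga–Lunts 1997, §3 (p. 14) "standard reduction" and §1: the Néron–Severi Lie algebra of a product of
# `Hom`-orthogonal abelian varieties is the product of the Néron–Severi Lie algebras,
# `𝔤_NS(X₁ × X₂; ℝ) ≅ 𝔤_NS(X₁; ℝ) × 𝔤_NS(X₂; ℝ)`, with `NS(X₁ × X₂) ⊗ ℝ = p₁^*NS(X₁) ⊗ ℝ ⊕ p₂^*NS(X₂) ⊗ ℝ`,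
# `h ↦ (h, h)`, `e_{p₁^*a₁ + p₂^*a₂} ↦ (e_{a₁}, e_{a₂})`, `f ↦ (f, f)` — and §1's exterior tensor product clause
# `𝔤(𝔞′ × 𝔞″, M′ ⊠ M″) = 𝔤(𝔞′, M′) × 𝔤(𝔞″, M″)` in the tree's model setting

Layer `Literature/Geometry/Kaehler`, namespace `Literature.Geometry.Kaehler.ComplexTorus`; lane `lit-hodgefound` (Track 2
foundations library, Layer A: Hodge theory of complex tori on invariant forms), skeleton seat `lit-hodgefound-skel-1`
(generation 33), row **A1-67** of `run/shared/lean/pub/lit-hodgefound/SKELETON.md`.  Sequel BY NAME of rows A1-54/A1-55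
(`ComplexTorusNeronSeveriLieAlgebra`: `𝔤_NS(X; ℝ) = neronSeveriLieAlgebra Φ`, the model
`ψ₋₂(𝒜^+κ⁻¹) ⊕ ψ₀(S^*) ⊕ ψ₂(κ𝒜^+) = model κ P₀ 𝒜 ⊂ 𝔰𝔬(V ⊕ V^*)`, `modelLie`, `llModel = ρ(model)`, the STRUCTURE
THEOREM `neronSeveriLieAlgebra_eq_llModel : 𝔤_NS(X; ℝ) = ρ(model(End(X) ⊗ ℝ, η₀))`, `modelEquivLLModel` (the spinor
representation `ρ` is a Lie isomorphism of the model onto `llModel`), `llAlgebra_formsOf_eq : 𝔤(𝔞(𝒜)) = llModel`,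
`formsOf_endAlgReal_eq : 𝔞(End(X) ⊗ ℝ) = NS(X) ⊗ ℝ`, `endAlgReal`, `rhoR`, `symmPart`, `symmProdSpan`, `sigmaMap`,
`rosatiAdj`, `transposeEnd`), A1-57 (`ComplexTorusNeronSeveriLieAlgebraIsogeny`: `isSl2Triple_map_of_injective`; the
isogeny-invariance half of the same reduction), `ComplexTorusProduct` (A2-x: the product torus `prodPeriod Φ₁ Φ₂` on
`E₁ × E₂`, the product form `prodForm ω₁ ω₂ = p₁^*ω₁ + p₂^*ω₂`, `IsRiemannForm.prod`, `latticeGram_prod`),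
`ComplexTorusEndomorphismAlgebraProduct` (`mem_endAlgRat_prod_iff`, `fromBlocks_mem_endAlgRat_prod_iff`: `End_ℚ(X₁ × X₂)` in
blocks, the off-diagonal blocks in `Hom_ℚ(X₂, X₁) = homRat Φ₂ Φ₁`, `Hom_ℚ(X₁, X₂)`), `ComplexTorusTotalLieAlgebra`
(`isSl2Triple_iff`, `eq_lefschetzDualG_of_isSl2Triple`, `spinorRepLin_gradingElement_eq_countingG`),
`ComplexTorusKaehlerLieAlgebra` (`flat`, `upEnd = ψ₂`, `lowEnd = ψ₋₂`, `spinorRepLin_upEnd : ρψ₂(η) = e_η`),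
`LinearAlgebra/Alternating/ExteriorAlgebraSpinorRepresentation` (`sumDual V = V ⊕ V^*`, `psi0 = ψ₀`, `gradingElement = u`,
`dualTranspose`, `spinorRepLin = ρ`) and Mathlib's `Algebra.Lie.Prod` (the product Lie algebra `L₁ × L₂`).  Definitions WITH
BODIES and theorems only: no named fact, no `sorry` (net debt `0`).

## Sources, VERBATIM

E. Looijenga, V. A. Lunts, *A Lie algebra attached to a projective variety*, Invent. Math. **129** (1997) 361–412 (held
text `paper:arxiv-alg-geom_9604014`; page/line numbers of that text):

> (§3, p0014 L96–L117) "In order to convert this into a more explicit statement, we first make a standard reduction.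
> The Néron–Severi Lie algebra of `X` only depends on the isogeny type. So by the Poincaré's complete reducibility
> theorem we may without loss of generality assume that the abelian variety is of the form
> `X = X₁^{m₁} × ⋯ × X_k^{m_k}` with `X₁, …, X_k` simple, pairwise non-isogenous abelian varieties. **Since the
> Néron–Severi group of `X` is just the direct sum of the Néron–Severi groups of its isotypical factors, the same is
> true for the Néron–Severi Lie algebra: `𝔤_NS(X) = 𝔤_NS(X₁^{m₁}) × ⋯ × 𝔤_NS(X_k^{m_k})`.** We therefore assume that
> `X` is a power `A^m` of a simple abelian variety `A`."
>
> (§1, p0004 L63) "The collection of Lefschetz modules is closed under direct sums, tensor products and taking duals."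
> (L72–L88) "There is also an exterior direct sum and tensor product: if `(𝔞′, M′)` and `(𝔞″, M″)` are Lefschetz modules,
> then we have defined Lefschetz modules `(𝔞′ × 𝔞″, M′ ⊞ M″)`, `e_{(a′,a″)}(m′, m″) = (e_{a′}m′, e_{a″}m″)`;
> `(𝔞′ × 𝔞″, M′ ⊠ M″)`, `e_{(a′,a″)}(m′ ⊗ m″) = e_{a′}m′ ⊗ m″ + m′ ⊗ e_{a″}m″`. **The associated Lie algebra is in the
> first case equal to `𝔤(𝔞′, M′) × 𝔤(𝔞″, M″)`. This is also true in the second case if both factors are nonzero.**"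
>
> (§1 (1.1), p0004 L4) "This `f` is then unique and `(e, h, f)` is a `𝔰𝔩(2)`-triple".

Inputs, also printed: K. Hulek, R. Laface, *On the Picard numbers of abelian varieties*, Ann. Sc. Norm. Super. Pisa (5) XIX
(2019), Prop. 2.2 / Cor. 2.3 (held `paper:arxiv-1703.05882` p0005: "`Hom(A_i, A_j) = Hom(A_i, A_j^∨) = 0` and every isogeny
`f : ∏ A_i^{n_i} → (∏ A_i^{n_i})^∨` is of the form `f = (f_1, …, f_r)` […] Since a direct sum of endomorphisms is hermitian
if and only if all its summands are, the claim follows […] `ρ(∏ A_i^{n_i}) = Σ ρ(A_i^{n_i})`"); H. Lange, *Abelian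
Varieties over the Complex Numbers* (2023), §2.4.4 Cor. 2.4.26 (proof, p. 124: "`End_ℚ(X) = ⊕_ν End_ℚ(X_ν^{n_ν})`" when
`Hom(X_ν, X_μ) = 0`), Cor. 2.4.24 (the product polarisation `p₁^*ω₁ + p₂^*ω₂` with Gram matrix `(G₁ 0; 0 G₂)`).

## Reading (dictionary) and mechanism

`Vᵢ = Eᵢ` (finite-dimensional complex vector spaces read over `ℝ`), `V = V₁ ⊕ V₂ = E₁ × E₂`; `H•(Xᵢ; ℂ) = GForm Eᵢ ℂ`,
`H•(X₁ × X₂; ℂ) = GForm (E₁ × E₂) ℂ`.  LL's `M′ ⊠ M″ = H•(X₁) ⊗ H•(X₂) ≅ H•(X₁ × X₂)` (Künneth) is NOT used: the tree reads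
`𝔤_NS` through the spinor representations `ρ : 𝔰𝔬(V ⊕ V^*) → 𝔤𝔩(H•(X; ℂ))`, which are Lie isomorphisms of the MODELS
onto the Lie algebras (`modelEquivLLModel`), and the models live in `𝔤𝔩(V ⊕ V^*)`, which is ADDITIVE in `V`:
`(V₁ ⊕ V₂) ⊕ (V₁ ⊕ V₂)^* ≅ (V₁ ⊕ V₁^*) ⊕ (V₂ ⊕ V₂^*)` (`sumDualProdEquiv`), whence the injective algebra homomorphism
`sumDualBlockDiag : 𝔤𝔩(V₁ ⊕ V₁^*) × 𝔤𝔩(V₂ ⊕ V₂^*) → 𝔤𝔩(V ⊕ V^*)` of block-diagonal operators (§1).  For block-diagonal data —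
the `2`-form `κ₁ ⊞ κ₂ = prodForm κ₁ κ₂`, the inverse `P₁ ⊕ P₂ = dualProdMap E₁ E₂ P₁ P₂` of its flat map, and the
block-diagonal subalgebra `𝒜₁ × 𝒜₂ = prodMapSubalgebra 𝒜₁ 𝒜₂ ⊆ End(V₁ ⊕ V₂)` (`a₁ × a₂ = LinearMap.prodMap a₁ a₂`) — the
involution, the symmetric part `𝒜^+`, the ideal `S = span(𝒜^+·𝒜^+)`, the forms `𝔞(𝒜)`, the three blocks `ψ₋₂ / ψ₀ / ψ₂` and
the model all split (§2–§4): `(a₁ × a₂)† = a₁† × a₂†`, `(𝒜₁ × 𝒜₂)^+ = 𝒜₁^+ × 𝒜₂^+`, `S(𝒜₁ × 𝒜₂) = S₁ × S₂`,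
`𝔞(𝒜₁ × 𝒜₂) = {a₁ ⊞ a₂ : aᵢ ∈ 𝔞(𝒜ᵢ)}`, `model(𝒜₁ × 𝒜₂) = sumDualBlockDiag(model₁ × model₂)`; hence the Lie algebra
ISOMORPHISMS `modelLieProdEquiv`, `llModelProdEquiv` and — by `llAlgebra_formsOf_eq` on the three carriers —
**`llAlgebraFormsOfProdEquiv : 𝔤(𝔞(𝒜₁ × 𝒜₂), H•(X₁ × X₂)) ≃ₗ⁅ℝ⁆ 𝔤(𝔞(𝒜₁), H•(X₁)) × 𝔤(𝔞(𝒜₂), H•(X₂))`**, which is the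
printed clause "`𝔤(𝔞′ × 𝔞″, M′ ⊠ M″) = 𝔤(𝔞′, M′) × 𝔤(𝔞″, M″)`" for the Lefschetz modules `(𝔞(𝒜ᵢ), H•(Xᵢ))` of the tree
(§3).  THE ABELIAN VARIETY (§5): for complex tori `Xᵢ = Eᵢ/Φᵢ(ℤ^{ιᵢ})` with `Hom_ℚ(X₁, X₂) = 0 = Hom_ℚ(X₂, X₁)`
(`homRat Φ₁ Φ₂ = ⊥`, `homRat Φ₂ Φ₁ = ⊥`) every rational endomorphism of `X₁ × X₂ = prodPeriod Φ₁ Φ₂` is block diagonal,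
`ρ(A 0; 0 D) = ρ₁(A) × ρ₂(D)` (`rhoR_prodPeriod_fromBlocks`), so **`End(X₁ × X₂) ⊗ ℝ = End(X₁) ⊗ ℝ × End(X₂) ⊗ ℝ`**
(`endAlgReal_prodPeriod_eq`); with Riemann forms `η₁`, `η₂` (and the product polarisation `η₁ ⊞ η₂`, `IsRiemannForm.prod`)
the structure theorem of A1-54 gives **`NS(X₁ × X₂) ⊗ ℝ = {p₁^*a₁ + p₂^*a₂ : aᵢ ∈ NS(Xᵢ) ⊗ ℝ}`**
(`mem_neronSeveriR_prodPeriod_iff`, "the Néron–Severi group of `X` is just the direct sum of the Néron–Severi groups of its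
isotypical factors", over `ℝ`) and **`neronSeveriLieAlgebraProdEquiv : 𝔤_NS(X₁ × X₂; ℝ) ≃ₗ⁅ℝ⁆ 𝔤_NS(X₁; ℝ) × 𝔤_NS(X₂; ℝ)`**
("the same is true for the Néron–Severi Lie algebra"), sending `ρ(sumDualBlockDiag(x₁, x₂)) ↦ (ρ₁ x₁, ρ₂ x₂)`, hence
`h ↦ (h, h)` (`_countingG`), `e_{p₁^*a₁ + p₂^*a₂} ↦ (e_{a₁}, e_{a₂})` (`_lefschetzG`), `f_{p₁^*a₁ + p₂^*a₂} ↦ (f_{a₁}, f_{a₂})`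
for Lefschetz `aᵢ` (`_lefschetzDualG`, by the uniqueness of the `𝔰𝔩₂`-partner, (1.1)), brackets with `h` (degrees)
componentwise (`_lie_countingG`), and **`dim_ℝ 𝔤_NS(X₁ × X₂; ℝ) = dim_ℝ 𝔤_NS(X₁; ℝ) + dim_ℝ 𝔤_NS(X₂; ℝ)`**
(`finrank_neronSeveriLieAlgebra_prodPeriod`; hypothesis-free forms `IsAbelianVariety.…`).

## What is formalised (all `theorem`s proved; definitions with bodies)

* §1 `sumDualProdEquiv` (`(V₁ ⊕ V₂) ⊕ (V₁ ⊕ V₂)^* ≃ₗ (V₁ ⊕ V₁^*) × (V₂ ⊕ V₂^*)`), **`sumDualBlockDiag`** (an injective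
  `ℝ`-algebra homomorphism, `sumDualBlockDiag_injective`), `dualProdMap` (`ξ ↦ (Q₁(ξ|V₁), Q₂(ξ|V₂))`), `dualEndProd`
  (`σ₁ ⊕ σ₂` on `(V₁ ⊕ V₂)^*`) and the block identities `sumDualBlockDiag_lowEnd` (`ψ₋₂`), `transposeEnd_prodMap`,
  `dualTranspose_dualEndProd`, `sumDualBlockDiag_psi0` (`ψ₀`), `sumDualBlockDiag_midMap`, `sumDualBlockDiag_gradingElement`
  (`u = (u₁, u₂)`), `flat_prodForm`, `sumDualBlockDiag_upEnd` (`ψ₂(κ₁ ⊞ κ₂) = (ψ₂(κ₁), ψ₂(κ₂))`), `sumDualBlockDiag_upMap`,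
  `sumDualBlockDiag_lowMap`.
* §2 `prodMapₗ`, `prodMap_eq_prodMap_iff`, `flat_prodForm_comp_dualProdMap` (`(κ₁ ⊞ κ₂)♭ ∘ (P₁ ⊕ P₂) = 1`),
  **`rosatiAdj_prodMap`** (`(a₁ × a₂)† = a₁† × a₂†`), **`prodMapSubalgebra`** (`𝒜₁ × 𝒜₂`, `mem_prodMapSubalgebra_iff`,
  `prodMapSubalgebra_adj`), `prodMap_mem_symmPart_iff` / **`symmPart_prod_eq`** (`(𝒜₁ × 𝒜₂)^+ = 𝒜₁^+ × 𝒜₂^+`),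
  **`symmProdSpan_prod_eq`** (`S = S₁ × S₂`), `upPiece_prod_eq`, `lowPiece_prod_eq`, `midPiece_prod_eq`, **`model_prod_eq`**
  (`model(𝒜₁ × 𝒜₂) = sumDualBlockDiag(model₁ × model₂)`), `mem_model_prod_iff`, `sumDualBlockDiag_mem_model_prod_iff`.
* §3 `lieEquivProdCongr` (`L₁ ≃ L₁'`, `L₂ ≃ L₂'` give `L₁ × L₂ ≃ L₁' × L₂'`), `modelLieProdHom` (injective, range the product
  model), **`modelLieProdEquiv : modelLie(𝒜₁ × 𝒜₂) ≃ₗ⁅ℝ⁆ modelLie 𝒜₁ × modelLie 𝒜₂`**, **`llModelProdEquiv`** (through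
  `modelEquivLLModel`; `coe_modelEquivLLModel_apply`, `llModelProdEquiv_symm_apply_coe`, `llModelProdEquiv_apply_of_eq`:
  `ρ(sumDualBlockDiag(x₁, x₂)) ↦ (ρ₁ x₁, ρ₂ x₂)`), **`llAlgebraFormsOfProdEquiv`** (LL §1's clause).
* §4 `sigmaMap_prodForm` (`σ_{a₁ ⊞ a₂} = σ_{a₁} × σ_{a₂}`), `prodForm_mem_formsOf_iff`, `restrictFst` / `restrictSnd`
  (`a ↦ a|V₁, a|V₂`), `prodForm_restrictFst_restrictSnd`, `apply_inl_inr_eq_zero_of_mem_formsOf` (a form of `𝔞(𝒜₁ × 𝒜₂)`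
  vanishes on `V₁ × V₂`), `eq_prodForm_of_mem_formsOf`, **`mem_formsOf_prod_iff`** (`𝔞(𝒜₁ × 𝒜₂) = p₁^*𝔞(𝒜₁) ⊕ p₂^*𝔞(𝒜₂)`).
* §5 **`rhoR_prodPeriod_fromBlocks`**, `prodMapSubalgebra_endAlgReal_le`, **`endAlgReal_prodPeriod_eq`**,
  (private `fromBlocks_ratCast_eq_latticeGram_prod`: the rational Gram matrix `(G₁ 0; 0 G₂)` of `η₁ ⊞ η₂`), **`mem_neronSeveriR_prodPeriod_iff`**, `prodForm_mem_neronSeveriR_prodPeriod_iff`,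
  **`neronSeveriLieAlgebra_prodPeriod_eq_llModel`**, `neronSeveriLieAlgebra_prodPeriod_toSubmodule`,
  **`neronSeveriLieAlgebraProdEquiv`** (+ `_apply_of_eq`, `_lefschetzG`, `_countingG`, `_lie_countingG`, `_lefschetzDualG`),
  `upEnd_mem_model_endAlgReal`, `lefschetzG_prodForm_mem_neronSeveriLieAlgebra`, `countingG_prod_mem_neronSeveriLieAlgebra`,
  `nondegenerate_prodForm_of_nondegenerate`, **`finrank_neronSeveriLieAlgebra_prodPeriod`**,
  **`IsAbelianVariety.nonempty_neronSeveriLieAlgebra_prodPeriod_equiv`**, `IsAbelianVariety.finrank_neronSeveriLieAlgebra_prodPeriod`.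

## SCOPE (what is NOT claimed)

(a) Binary products only; the printed `k`-fold statement for the isotypic decomposition `X₁^{m₁} × ⋯ × X_k^{m_k}` follows by
iterating this file (the factors `X_i^{m_i}`, `∏_{j≠i} X_j^{m_j}` are `Hom`-orthogonal); an `n`-fold `piPeriod` version
is not written.  (b) OVER `ℝ`: `𝔤_NS(X; ℝ)` of A1-54; the `ℚ`-forms `𝔤_NS(X; ℚ)` (A1-60) and `NS_ℚ` are not treated here
(`NS(X₁ × X₂) ⊗ ℝ` is identified, not `NS(X₁ × X₂)`; the integral/rational statement is Hulek–Laface Prop. 2.2 and the tree's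
`ComplexTorusPicardNumberProduct`).  (c) BOTH vanishings `Hom_ℚ(X₁, X₂) = 0` and `Hom_ℚ(X₂, X₁) = 0` are hypotheses (for
abelian varieties either implies the other, `finrank_homRat_comm_of_isAbelianVariety` of `ComplexTorusPicardNumberProduct`,
not imported).  (d) The isogeny-invariance half of the reduction is A1-57 and Poincaré reducibility is A2's; neither is
restated.  (e) The abstract Lefschetz-module notions `(𝔞, M)`, `M′ ⊠ M″` are not introduced: §3 is the clause for the
tree's models `𝔤(𝔞(𝒜), H•(X))` of algebras with involution, read through the spinor representations.
-/

noncomputable section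

open Module Function Complex
open scoped Matrix
open Literature.LinearAlgebra.Alternating

-- Commutator brackets on the associative algebras `End_ℝ(V ⊕ V^*)`, `End_ℂ(⋀^• V^* ⊗ ℂ)` are by
-- `LieRing.ofAssociativeRing`, enabled file-locally exactly as in `ComplexTorusNeronSeveriLieAlgebra.lean`.
attribute [local instance 100] LieRing.ofAssociativeRing

namespace Literature.Geometry.Kaehler

namespace ComplexTorus

/-! ### §1 The block-diagonal device `𝔤𝔩(V₁ ⊕ V₁^*) × 𝔤𝔩(V₂ ⊕ V₂^*) → 𝔤𝔩((V₁ ⊕ V₂) ⊕ (V₁ ⊕ V₂)^*)` -/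

section BlockDiag

variable (E₁ E₂ : Type*) [NormedAddCommGroup E₁] [NormedSpace ℂ E₁] [NormedAddCommGroup E₂] [NormedSpace ℂ E₂]

/-- **`(V₁ ⊕ V₂) ⊕ (V₁ ⊕ V₂)^* ≃ (V₁ ⊕ V₁^*) × (V₂ ⊕ V₂^*)`**: `((x₁, x₂), ξ) ↦ ((x₁, ξ|V₁), (x₂, ξ|V₂))`, with inverse
`((x₁, ξ₁), (x₂, ξ₂)) ↦ ((x₁, x₂), ξ₁ ∘ p₁ + ξ₂ ∘ p₂)` — the additivity of `V ↦ V ⊕ V^*` in which the block-diagonal device lives.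
[cite: LooijengaLunts1997, §3 (3.1)] [cite: LooijengaLunts1997, §1 (p. 4, exterior direct sum and tensor product)] -/
def sumDualProdEquiv : sumDual (E₁ × E₂) ≃ₗ[ℝ] sumDual E₁ × sumDual E₂ where
  toFun z := ((z.1.1, z.2.comp (ContinuousLinearMap.inl ℝ E₁ E₂)), (z.1.2, z.2.comp (ContinuousLinearMap.inr ℝ E₁ E₂)))
  invFun w := ((w.1.1, w.2.1), w.1.2.coprod w.2.2)
  map_add' z z' := Prod.ext (Prod.ext rfl (ContinuousLinearMap.add_comp _ _ _))
    (Prod.ext rfl (ContinuousLinearMap.add_comp _ _ _))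
  map_smul' c z := Prod.ext (Prod.ext rfl (ContinuousLinearMap.smul_comp _ _ _))
    (Prod.ext rfl (ContinuousLinearMap.smul_comp _ _ _))
  left_inv z := by
    refine Prod.ext rfl (ContinuousLinearMap.ext fun x ↦ ?_)
    change z.2 (ContinuousLinearMap.inl ℝ E₁ E₂ x.1) + z.2 (ContinuousLinearMap.inr ℝ E₁ E₂ x.2) = z.2 x
    rw [← map_add, ContinuousLinearMap.inl_apply, ContinuousLinearMap.inr_apply, Prod.mk_add_mk, add_zero, zero_add]
  right_inv w := by
    refine Prod.ext (Prod.ext rfl ?_) (Prod.ext rfl ?_)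
    · refine ContinuousLinearMap.ext fun x ↦ ?_
      change w.1.2 x + w.2.2 0 = w.1.2 x
      rw [map_zero, add_zero]
    · refine ContinuousLinearMap.ext fun y ↦ ?_
      change w.1.2 0 + w.2.2 y = w.2.2 y
      rw [map_zero, zero_add]

/-- unfolding of `sumDualProdEquiv` (definitional). [cite: LooijengaLunts1997, §3 (3.1)] -/
@[simp]
theorem sumDualProdEquiv_apply (z : sumDual (E₁ × E₂)) :
    sumDualProdEquiv E₁ E₂ z =
      ((z.1.1, z.2.comp (ContinuousLinearMap.inl ℝ E₁ E₂)), (z.1.2, z.2.comp (ContinuousLinearMap.inr ℝ E₁ E₂))) :=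
  rfl

/-- unfolding of the inverse of `sumDualProdEquiv` (definitional). [cite: LooijengaLunts1997, §3 (3.1)] -/
@[simp]
theorem sumDualProdEquiv_symm_apply (w : sumDual E₁ × sumDual E₂) :
    (sumDualProdEquiv E₁ E₂).symm w = ((w.1.1, w.2.1), w.1.2.coprod w.2.2) :=
  rfl

/-- **The block-diagonal embedding `𝔤𝔩(V₁ ⊕ V₁^*) × 𝔤𝔩(V₂ ⊕ V₂^*) → 𝔤𝔩((V₁ ⊕ V₂) ⊕ (V₁ ⊕ V₂)^*)`**,
`(T₁, T₂) ↦ T₁ ⊕ T₂` (conjugated by `sumDualProdEquiv`), an `ℝ`-algebra homomorphism — hence a homomorphism of the commutator Lie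
algebras; it carries the product of two models onto the model of the block-diagonal data (`model_prod_eq`).
[cite: LooijengaLunts1997, §1 (p. 4, exterior direct sum and tensor product)] [cite: LooijengaLunts1997, §3 (p. 14, standard reduction: 𝔤_NS(X) = 𝔤_NS(X₁^m₁) × ⋯ × 𝔤_NS(X_k^m_k))] -/
def sumDualBlockDiag : (Module.End ℝ (sumDual E₁) × Module.End ℝ (sumDual E₂)) →ₐ[ℝ] Module.End ℝ (sumDual (E₁ × E₂)) where
  toFun T := (sumDualProdEquiv E₁ E₂).symm.toLinearMap ∘ₗ T.1.prodMap T.2 ∘ₗ (sumDualProdEquiv E₁ E₂).toLinearMap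
  map_one' := by
    refine LinearMap.ext fun z ↦ ?_
    simp only [LinearMap.comp_apply, LinearEquiv.coe_toLinearMap, Prod.fst_one, Prod.snd_one, LinearMap.prodMap_apply,
      Module.End.one_apply, Prod.mk.eta, LinearEquiv.symm_apply_apply]
  map_mul' S T := by
    refine LinearMap.ext fun z ↦ ?_
    simp only [LinearMap.comp_apply, LinearEquiv.coe_toLinearMap, Prod.fst_mul, Prod.snd_mul, LinearMap.prodMap_apply,
      Module.End.mul_apply, LinearEquiv.apply_symm_apply]
  map_zero' := by
    refine LinearMap.ext fun z ↦ ?_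
    simp only [LinearMap.comp_apply, LinearEquiv.coe_toLinearMap, Prod.fst_zero, Prod.snd_zero, LinearMap.prodMap_apply,
      LinearMap.zero_apply, Prod.mk_zero_zero, map_zero]
  map_add' S T := by
    refine LinearMap.ext fun z ↦ ?_
    simp only [LinearMap.comp_apply, LinearEquiv.coe_toLinearMap, Prod.fst_add, Prod.snd_add, LinearMap.prodMap_apply,
      LinearMap.add_apply]
    rw [← map_add]
    rfl
  commutes' r := by
    refine LinearMap.ext fun z ↦ ?_
    simp only [Prod.algebraMap_apply, Module.algebraMap_end_apply, LinearMap.comp_apply, LinearEquiv.coe_toLinearMap,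
      LinearMap.prodMap_apply]
    rw [← Prod.smul_mk, Prod.mk.eta, map_smul, LinearEquiv.symm_apply_apply]

variable {E₁ E₂}

/-- unfolding of `sumDualBlockDiag` (definitional). [cite: LooijengaLunts1997, §1 (p. 4, exterior direct sum and tensor product)] -/
theorem sumDualBlockDiag_apply (T : Module.End ℝ (sumDual E₁) × Module.End ℝ (sumDual E₂)) (z : sumDual (E₁ × E₂)) :
    sumDualBlockDiag E₁ E₂ T z =
      (sumDualProdEquiv E₁ E₂).symm (T.1 (sumDualProdEquiv E₁ E₂ z).1, T.2 (sumDualProdEquiv E₁ E₂ z).2) :=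
  rfl

/-- `sumDualBlockDiag (T₁, T₂)` acts as `(T₁, T₂)` in the coordinates `(V₁ ⊕ V₁^*) × (V₂ ⊕ V₂^*)`. [cite: LooijengaLunts1997, §1 (p. 4, exterior direct sum and tensor product)] -/
theorem sumDualProdEquiv_sumDualBlockDiag_apply (T : Module.End ℝ (sumDual E₁) × Module.End ℝ (sumDual E₂))
    (z : sumDual (E₁ × E₂)) :
    sumDualProdEquiv E₁ E₂ (sumDualBlockDiag E₁ E₂ T z) = (T.1 (sumDualProdEquiv E₁ E₂ z).1, T.2 (sumDualProdEquiv E₁ E₂ z).2) := by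
  rw [sumDualBlockDiag_apply, LinearEquiv.apply_symm_apply]

/-- `sumDualBlockDiag (T₁, T₂)` on a vector given in the coordinates `(V₁ ⊕ V₁^*) × (V₂ ⊕ V₂^*)`. [cite: LooijengaLunts1997, §1 (p. 4, exterior direct sum and tensor product)] -/
theorem sumDualBlockDiag_apply_symm (T : Module.End ℝ (sumDual E₁) × Module.End ℝ (sumDual E₂)) (w : sumDual E₁ × sumDual E₂) :
    sumDualBlockDiag E₁ E₂ T ((sumDualProdEquiv E₁ E₂).symm w) = (sumDualProdEquiv E₁ E₂).symm (T.1 w.1, T.2 w.2) := by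
  rw [sumDualBlockDiag_apply, LinearEquiv.apply_symm_apply]

/-- The block-diagonal embedding is injective. [cite: LooijengaLunts1997, §1 (p. 4, exterior direct sum and tensor product)] -/
theorem sumDualBlockDiag_injective : Injective (sumDualBlockDiag E₁ E₂) := by
  intro S T h
  have key : ∀ w : sumDual E₁ × sumDual E₂, (S.1 w.1, S.2 w.2) = (T.1 w.1, T.2 w.2) := fun w ↦ by
    have h' := congrArg (fun F ↦ sumDualProdEquiv E₁ E₂ (F ((sumDualProdEquiv E₁ E₂).symm w))) h
    simpa only [sumDualBlockDiag_apply_symm, LinearEquiv.apply_symm_apply] using h'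
  refine Prod.ext (LinearMap.ext fun x ↦ ?_) (LinearMap.ext fun y ↦ ?_)
  · simpa using congrArg Prod.fst (key (x, 0))
  · simpa using congrArg Prod.snd (key (0, y))

/-- The two blocks annihilate each other: `(S₁ ⊕ 0)(0 ⊕ T₂) = 0` (so the two factors commute inside `𝔤𝔩(V ⊕ V^*)`). [cite: LooijengaLunts1997, §1 (p. 4, exterior direct sum and tensor product)] -/
theorem sumDualBlockDiag_mul_comm_of (S₁ : Module.End ℝ (sumDual E₁)) (T₂ : Module.End ℝ (sumDual E₂)) :
    sumDualBlockDiag E₁ E₂ (S₁, 0) * sumDualBlockDiag E₁ E₂ (0, T₂) = 0 := by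
  rw [← map_mul, Prod.mk_mul_mk, mul_zero, zero_mul, Prod.mk_zero_zero, map_zero]


/-! #### The blocks `ψ₋₂`, `ψ₀`, `ψ₂`, `u` of block-diagonal data -/

variable (E₁ E₂) in
/-- **`P₁ ⊕ P₂ : (V₁ ⊕ V₂)^* → V₁ ⊕ V₂`, `ξ ↦ (P₁(ξ|V₁), P₂(ξ|V₂))`** — for inverses `Pᵢ` of the flat maps `κᵢ♭` this is the
inverse of `(κ₁ ⊞ κ₂)♭` (`flat_prodForm_comp_dualProdMap`). [cite: LooijengaLunts1997, §3 (3.5)] -/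
def dualProdMap (Q₁ : (E₁ →L[ℝ] ℝ) →ₗ[ℝ] E₁) (Q₂ : (E₂ →L[ℝ] ℝ) →ₗ[ℝ] E₂) : ((E₁ × E₂) →L[ℝ] ℝ) →ₗ[ℝ] E₁ × E₂ where
  toFun ξ := (Q₁ (ξ.comp (ContinuousLinearMap.inl ℝ E₁ E₂)), Q₂ (ξ.comp (ContinuousLinearMap.inr ℝ E₁ E₂)))
  map_add' ξ ζ := by
    rw [ContinuousLinearMap.add_comp, ContinuousLinearMap.add_comp, map_add, map_add, Prod.mk_add_mk]
  map_smul' c ξ := by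
    rw [ContinuousLinearMap.smul_comp, ContinuousLinearMap.smul_comp, map_smul, map_smul, RingHom.id_apply, Prod.smul_mk]

/-- unfolding of `dualProdMap` (definitional). [cite: LooijengaLunts1997, §3 (3.5)] -/
@[simp]
theorem dualProdMap_apply (Q₁ : (E₁ →L[ℝ] ℝ) →ₗ[ℝ] E₁) (Q₂ : (E₂ →L[ℝ] ℝ) →ₗ[ℝ] E₂) (ξ : (E₁ × E₂) →L[ℝ] ℝ) :
    dualProdMap E₁ E₂ Q₁ Q₂ ξ =
      (Q₁ (ξ.comp (ContinuousLinearMap.inl ℝ E₁ E₂)), Q₂ (ξ.comp (ContinuousLinearMap.inr ℝ E₁ E₂))) :=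
  rfl

/-- `(P₁ ⊕ P₂)(ξ₁ ∘ p₁ + ξ₂ ∘ p₂) = (P₁ ξ₁, P₂ ξ₂)`. [cite: LooijengaLunts1997, §3 (3.5)] -/
theorem dualProdMap_coprod (Q₁ : (E₁ →L[ℝ] ℝ) →ₗ[ℝ] E₁) (Q₂ : (E₂ →L[ℝ] ℝ) →ₗ[ℝ] E₂) (ξ₁ : E₁ →L[ℝ] ℝ)
    (ξ₂ : E₂ →L[ℝ] ℝ) : dualProdMap E₁ E₂ Q₁ Q₂ (ξ₁.coprod ξ₂) = (Q₁ ξ₁, Q₂ ξ₂) := by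
  rw [dualProdMap_apply, ContinuousLinearMap.coprod_comp_inl, ContinuousLinearMap.coprod_comp_inr]

/-- `(β₁ × β₂) ∘ (P₁ ⊕ P₂) = (β₁ ∘ P₁) ⊕ (β₂ ∘ P₂)` (definitional). [cite: LooijengaLunts1997, §3 (3.5)] -/
theorem prodMap_comp_dualProdMap (β₁ : E₁ →ₗ[ℝ] E₁) (β₂ : E₂ →ₗ[ℝ] E₂) (Q₁ : (E₁ →L[ℝ] ℝ) →ₗ[ℝ] E₁)
    (Q₂ : (E₂ →L[ℝ] ℝ) →ₗ[ℝ] E₂) :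
    β₁.prodMap β₂ ∘ₗ dualProdMap E₁ E₂ Q₁ Q₂ = dualProdMap E₁ E₂ (β₁ ∘ₗ Q₁) (β₂ ∘ₗ Q₂) :=
  LinearMap.ext fun _ ↦ rfl

/-- **`ψ₋₂` is block diagonal**: `(ψ₋₂(Q₁), ψ₋₂(Q₂)) ↦ ψ₋₂(Q₁ ⊕ Q₂)`. [cite: LooijengaLunts1997, §3 (3.1)] -/
theorem sumDualBlockDiag_lowEnd (Q₁ : (E₁ →L[ℝ] ℝ) →ₗ[ℝ] E₁) (Q₂ : (E₂ →L[ℝ] ℝ) →ₗ[ℝ] E₂) :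
    sumDualBlockDiag E₁ E₂ (lowEnd Q₁, lowEnd Q₂) = lowEnd (dualProdMap E₁ E₂ Q₁ Q₂) := by
  refine LinearMap.ext fun z ↦ ?_
  rw [sumDualBlockDiag_apply, lowEnd_apply, lowEnd_apply, lowEnd_apply, sumDualProdEquiv_symm_apply]
  refine Prod.ext rfl ?_
  change (0 : E₁ →L[ℝ] ℝ).coprod (0 : E₂ →L[ℝ] ℝ) = 0
  exact ContinuousLinearMap.ext fun x ↦ by simp

variable (E₁ E₂) in
/-- **`σ₁ ⊕ σ₂ ∈ 𝔤𝔩((V₁ ⊕ V₂)^*)`** for `σᵢ ∈ 𝔤𝔩(Vᵢ^*)`: `ξ ↦ σ₁(ξ|V₁) ∘ p₁ + σ₂(ξ|V₂) ∘ p₂`. [cite: LooijengaLunts1997, §3 (3.1)] -/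
def dualEndProd (σ₁ : Module.End ℝ (E₁ →L[ℝ] ℝ)) (σ₂ : Module.End ℝ (E₂ →L[ℝ] ℝ)) :
    Module.End ℝ ((E₁ × E₂) →L[ℝ] ℝ) where
  toFun ξ := (σ₁ (ξ.comp (ContinuousLinearMap.inl ℝ E₁ E₂))).coprod (σ₂ (ξ.comp (ContinuousLinearMap.inr ℝ E₁ E₂)))
  map_add' ξ ζ := by
    rw [ContinuousLinearMap.add_comp, ContinuousLinearMap.add_comp, map_add, map_add]
    exact ContinuousLinearMap.ext fun x ↦ by simp [ContinuousLinearMap.coprod_apply, add_add_add_comm]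
  map_smul' c ξ := by
    rw [ContinuousLinearMap.smul_comp, ContinuousLinearMap.smul_comp, map_smul, map_smul, RingHom.id_apply]
    exact ContinuousLinearMap.ext fun x ↦ by simp [ContinuousLinearMap.coprod_apply, mul_add]

/-- unfolding of `dualEndProd` (definitional). [cite: LooijengaLunts1997, §3 (3.1)] -/
@[simp]
theorem dualEndProd_apply (σ₁ : Module.End ℝ (E₁ →L[ℝ] ℝ)) (σ₂ : Module.End ℝ (E₂ →L[ℝ] ℝ))
    (ξ : (E₁ × E₂) →L[ℝ] ℝ) :
    dualEndProd E₁ E₂ σ₁ σ₂ ξ =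
      (σ₁ (ξ.comp (ContinuousLinearMap.inl ℝ E₁ E₂))).coprod (σ₂ (ξ.comp (ContinuousLinearMap.inr ℝ E₁ E₂))) :=
  rfl

/-- **The degree-`-2` block map splits**: `(ψ₋₂(β₁ ∘ P₁), ψ₋₂(β₂ ∘ P₂)) ↦ ψ₋₂((β₁ × β₂) ∘ (P₁ ⊕ P₂))`. [cite: LooijengaLunts1997, §3 (3.6)] -/
theorem sumDualBlockDiag_lowMap (Q₁ : (E₁ →L[ℝ] ℝ) →ₗ[ℝ] E₁) (Q₂ : (E₂ →L[ℝ] ℝ) →ₗ[ℝ] E₂) (β₁ : E₁ →ₗ[ℝ] E₁)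
    (β₂ : E₂ →ₗ[ℝ] E₂) :
    sumDualBlockDiag E₁ E₂ (lowMap Q₁ β₁, lowMap Q₂ β₂) = lowMap (dualProdMap E₁ E₂ Q₁ Q₂) (β₁.prodMap β₂) := by
  rw [lowMap_apply, lowMap_apply, lowMap_apply, sumDualBlockDiag_lowEnd, prodMap_comp_dualProdMap]

section FinDim

variable [FiniteDimensional ℂ E₁] [FiniteDimensional ℂ E₂]

/-- **`(s₁ × s₂)^* = s₁^* ⊕ s₂^*`**: the transpose of a block-diagonal operator is block diagonal. [cite: Lang2002, III §6] [cite: LooijengaLunts1997, §3 (3.1)] -/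
theorem transposeEnd_prodMap (s₁ : E₁ →ₗ[ℝ] E₁) (s₂ : E₂ →ₗ[ℝ] E₂) :
    transposeEnd (s₁.prodMap s₂) = dualEndProd E₁ E₂ (transposeEnd s₁) (transposeEnd s₂) := by
  refine LinearMap.ext fun ξ ↦ ContinuousLinearMap.ext fun x ↦ ?_
  rw [transposeEnd_apply, dualEndProd_apply, ContinuousLinearMap.coprod_apply, transposeEnd_apply, transposeEnd_apply,
    ContinuousLinearMap.comp_apply, ContinuousLinearMap.comp_apply, ContinuousLinearMap.inl_apply,
    ContinuousLinearMap.inr_apply, ← map_add, Prod.mk_add_mk, add_zero, zero_add, LinearMap.prodMap_apply]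

/-- `(σ₁ ⊕ σ₂)^T = σ₁^T × σ₂^T` on `V₁ ⊕ V₂`. [cite: Lang2002, III §6] [cite: LooijengaLunts1997, §3 (3.1)] -/
theorem dualTranspose_dualEndProd (σ₁ : Module.End ℝ (E₁ →L[ℝ] ℝ)) (σ₂ : Module.End ℝ (E₂ →L[ℝ] ℝ)) (x : E₁ × E₂) :
    dualTranspose (E₁ × E₂) (dualEndProd E₁ E₂ σ₁ σ₂) x = (dualTranspose E₁ σ₁ x.1, dualTranspose E₂ σ₂ x.2) := by
  rw [← sub_eq_zero]
  refine eq_zero_of_forall_apply_eq_zero (E₁ × E₂) fun ξ ↦ ?_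
  rw [map_sub, apply_dualTranspose, dualEndProd_apply, ContinuousLinearMap.coprod_apply, sub_eq_zero]
  have hx : ((dualTranspose E₁ σ₁ x.1, dualTranspose E₂ σ₂ x.2) : E₁ × E₂) =
      ContinuousLinearMap.inl ℝ E₁ E₂ (dualTranspose E₁ σ₁ x.1) +
        ContinuousLinearMap.inr ℝ E₁ E₂ (dualTranspose E₂ σ₂ x.2) := by
    rw [ContinuousLinearMap.inl_apply, ContinuousLinearMap.inr_apply, Prod.mk_add_mk, add_zero, zero_add]
  rw [hx, map_add, ← ContinuousLinearMap.comp_apply, ← ContinuousLinearMap.comp_apply, apply_dualTranspose,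
    apply_dualTranspose]

/-- **`ψ₀` is block diagonal**: `(ψ₀(σ₁), ψ₀(σ₂)) ↦ ψ₀(σ₁ ⊕ σ₂)`. [cite: LooijengaLunts1997, §3 (3.1)] -/
theorem sumDualBlockDiag_psi0 (σ₁ : Module.End ℝ (E₁ →L[ℝ] ℝ)) (σ₂ : Module.End ℝ (E₂ →L[ℝ] ℝ)) :
    sumDualBlockDiag E₁ E₂ (psi0 E₁ σ₁, psi0 E₂ σ₂) = psi0 (E₁ × E₂) (dualEndProd E₁ E₂ σ₁ σ₂) := by
  refine LinearMap.ext fun z ↦ ?_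
  simp only [sumDualBlockDiag_apply, sumDualProdEquiv_symm_apply, sumDualProdEquiv_apply, psi0_apply,
    dualTranspose_dualEndProd, dualEndProd_apply, Prod.neg_mk]

/-- **The degree-`0` block map splits**: `(ψ₀(s₁^*), ψ₀(s₂^*)) ↦ ψ₀((s₁ × s₂)^*)`. [cite: LooijengaLunts1997, §3 (3.6)] -/
theorem sumDualBlockDiag_midMap (s₁ : E₁ →ₗ[ℝ] E₁) (s₂ : E₂ →ₗ[ℝ] E₂) :
    sumDualBlockDiag E₁ E₂ (midMap E₁ s₁, midMap E₂ s₂) = midMap (E₁ × E₂) (s₁.prodMap s₂) := by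
  rw [midMap_apply, midMap_apply, midMap_apply, transposeEnd_prodMap, sumDualBlockDiag_psi0]

/-- **`u = (u₁, u₂)`**: the grading element of `V₁ ⊕ V₂` is the block-diagonal sum of the grading elements. [cite: LooijengaLunts1997, §3 (3.1)] -/
theorem sumDualBlockDiag_gradingElement :
    sumDualBlockDiag E₁ E₂ (gradingElement E₁, gradingElement E₂) = gradingElement (E₁ × E₂) := by
  rw [← midMap_one, ← midMap_one, ← midMap_one, sumDualBlockDiag_midMap, LinearMap.prodMap_one]

/-- `(κ₁ ⊞ κ₂)♭(x₁, x₂) = κ₁♭(x₁) ∘ p₁ + κ₂♭(x₂) ∘ p₂`. [cite: Lange2023AbelianVarietiesComplex, §2.4.4 Cor. 2.4.24] -/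
theorem flat_prodForm (κ₁ : E₁ [⋀^Fin 2]→L[ℝ] ℝ) (κ₂ : E₂ [⋀^Fin 2]→L[ℝ] ℝ) (x : E₁ × E₂) :
    flat (prodForm κ₁ κ₂) x = (flat κ₁ x.1).coprod (flat κ₂ x.2) :=
  ContinuousLinearMap.ext fun y ↦ by
    rw [flat_apply, prodForm_apply, ContinuousLinearMap.coprod_apply, flat_apply, flat_apply]

/-- **`ψ₂(κ₁ ⊞ κ₂) = (ψ₂(κ₁), ψ₂(κ₂))`**: `ψ₂` is block diagonal on product forms. [cite: LooijengaLunts1997, §3 (3.1)] -/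
theorem sumDualBlockDiag_upEnd (κ₁ : E₁ [⋀^Fin 2]→L[ℝ] ℝ) (κ₂ : E₂ [⋀^Fin 2]→L[ℝ] ℝ) :
    sumDualBlockDiag E₁ E₂ (upEnd κ₁, upEnd κ₂) = upEnd (prodForm κ₁ κ₂) := by
  refine LinearMap.ext fun z ↦ ?_
  rw [sumDualBlockDiag_apply, upEnd_apply, upEnd_apply, upEnd_apply, sumDualProdEquiv_symm_apply, flat_prodForm]
  rfl

/-- **The degree-`2` block map splits**: `(ψ₂(κ₁(α₁·,·)), ψ₂(κ₂(α₂·,·))) ↦ ψ₂((κ₁ ⊞ κ₂)((α₁ × α₂)·,·))`. [cite: LooijengaLunts1997, §3 (3.6)] -/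
theorem sumDualBlockDiag_upMap (κ₁ : E₁ [⋀^Fin 2]→L[ℝ] ℝ) (κ₂ : E₂ [⋀^Fin 2]→L[ℝ] ℝ) (α₁ : E₁ →ₗ[ℝ] E₁)
    (α₂ : E₂ →ₗ[ℝ] E₂) :
    sumDualBlockDiag E₁ E₂ (upMap κ₁ α₁, upMap κ₂ α₂) = upMap (prodForm κ₁ κ₂) (α₁.prodMap α₂) := by
  refine LinearMap.ext fun z ↦ ?_
  rw [sumDualBlockDiag_apply, upMap_apply, upMap_apply, upMap_apply, sumDualProdEquiv_symm_apply, LinearMap.prodMap_apply,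
    flat_prodForm]
  rfl

end FinDim

end BlockDiag


/-! ### §2 Block-diagonal data: `κ₁ ⊞ κ₂`, `P₁ ⊕ P₂`, `𝒜₁ × 𝒜₂`; `(𝒜₁ × 𝒜₂)^+ = 𝒜₁^+ × 𝒜₂^+`, `S = S₁ × S₂` -/

section BlockData

variable {E₁ E₂ : Type*} [NormedAddCommGroup E₁] [NormedSpace ℂ E₁] [NormedAddCommGroup E₂] [NormedSpace ℂ E₂]
  [FiniteDimensional ℂ E₁] [FiniteDimensional ℂ E₂]

variable (E₁ E₂) in
/-- `(a₁, a₂) ↦ a₁ × a₂ = LinearMap.prodMap a₁ a₂ : End(V₁) × End(V₂) → End(V₁ ⊕ V₂)` as a linear map (Mathlib's `LinearMap.prodMapAlgHom`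
read linearly) — the block-diagonal endomorphisms of `V₁ ⊕ V₂`, "`f = (f₁, …, f_r)`". [cite: HulekLaface2019PicardNumbers, Prop. 2.2 / Cor. 2.3] [cite: Lange2023AbelianVarietiesComplex, §2.4.4 Cor. 2.4.26 (proof)] -/
def prodMapₗ : (Module.End ℝ E₁ × Module.End ℝ E₂) →ₗ[ℝ] Module.End ℝ (E₁ × E₂) :=
  (LinearMap.prodMapAlgHom ℝ E₁ E₂).toLinearMap

omit [FiniteDimensional ℂ E₁] [FiniteDimensional ℂ E₂] in
/-- unfolding of `prodMapₗ` (definitional). [cite: Lange2023AbelianVarietiesComplex, §2.4.4 Cor. 2.4.26 (proof)] -/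
@[simp]
theorem prodMapₗ_apply (a : Module.End ℝ E₁ × Module.End ℝ E₂) : prodMapₗ E₁ E₂ a = a.1.prodMap a.2 := rfl

omit [FiniteDimensional ℂ E₁] [FiniteDimensional ℂ E₂] in
/-- `a₁ × a₂ = b₁ × b₂ ⟺ a₁ = b₁ ∧ a₂ = b₂`. [cite: Lange2023AbelianVarietiesComplex, §2.4.4 Cor. 2.4.26 (proof)] -/
theorem prodMap_eq_prodMap_iff {a₁ b₁ : Module.End ℝ E₁} {a₂ b₂ : Module.End ℝ E₂} :
    a₁.prodMap a₂ = b₁.prodMap b₂ ↔ a₁ = b₁ ∧ a₂ = b₂ := by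
  refine ⟨fun h ↦ ⟨LinearMap.ext fun x ↦ ?_, LinearMap.ext fun y ↦ ?_⟩, fun h ↦ by rw [h.1, h.2]⟩
  · simpa using congrArg (fun f ↦ (f (x, 0)).1) h
  · simpa using congrArg (fun f ↦ (f (0, y)).2) h

omit [FiniteDimensional ℂ E₁] [FiniteDimensional ℂ E₂] in
/-- `(a₁, a₂) ↦ a₁ × a₂` is injective. [cite: Lange2023AbelianVarietiesComplex, §2.4.4 Cor. 2.4.26 (proof)] -/
theorem prodMapₗ_injective : Injective (prodMapₗ E₁ E₂) := fun _ _ h ↦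
  Prod.ext (prodMap_eq_prodMap_iff.1 h).1 (prodMap_eq_prodMap_iff.1 h).2

omit [FiniteDimensional ℂ E₁] [FiniteDimensional ℂ E₂] in
/-- `(p × q).map (f × g) = p.map f × q.map g` for submodules (plumbing). [folklore] -/
private theorem map_prodMap_prod {R M₁ M₂ N₁ N₂ : Type*} [Semiring R] [AddCommMonoid M₁] [Module R M₁]
    [AddCommMonoid M₂] [Module R M₂] [AddCommMonoid N₁] [Module R N₁] [AddCommMonoid N₂] [Module R N₂]
    (f : M₁ →ₗ[R] N₁) (g : M₂ →ₗ[R] N₂) (p : Submodule R M₁) (q : Submodule R M₂) :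
    (p.prod q).map (f.prodMap g) = (p.map f).prod (q.map g) := by
  ext x
  simp only [Submodule.mem_map, Submodule.mem_prod, LinearMap.prodMap_apply, Prod.exists]
  constructor
  · rintro ⟨a, b, ⟨ha, hb⟩, rfl⟩
    exact ⟨⟨a, ha, rfl⟩, ⟨b, hb, rfl⟩⟩
  · rintro ⟨⟨a, ha, h1⟩, ⟨b, hb, h2⟩⟩
    exact ⟨a, b, ⟨ha, hb⟩, Prod.ext h1 h2⟩

variable {κ₁ : E₁ [⋀^Fin 2]→L[ℝ] ℝ} {κ₂ : E₂ [⋀^Fin 2]→L[ℝ] ℝ} {P₁ : (E₁ →L[ℝ] ℝ) →ₗ[ℝ] E₁} {P₂ : (E₂ →L[ℝ] ℝ) →ₗ[ℝ] E₂}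

omit [FiniteDimensional ℂ E₁] [FiniteDimensional ℂ E₂] in
/-- `κ(P₀ ζ, ·) = ζ` for an inverse `P₀` of `κ♭`. [cite: LooijengaLunts1997, §3 (3.5)] -/
private theorem flat_apply_rinv {E : Type*} [NormedAddCommGroup E] [NormedSpace ℂ E] [FiniteDimensional ℂ E]
    {κ : E [⋀^Fin 2]→L[ℝ] ℝ}
    {P₀ : (E →L[ℝ] ℝ) →ₗ[ℝ] E} (h₁ : flat κ ∘ₗ P₀ = 1) (ζ : E →L[ℝ] ℝ) : flat κ (P₀ ζ) = ζ := by
  rw [← LinearMap.comp_apply, h₁, Module.End.one_apply]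

/-- **`(κ₁ ⊞ κ₂)♭ ∘ (P₁ ⊕ P₂) = 1`**: the product of two non-degenerate forms is non-degenerate, with inverse `P₁ ⊕ P₂`. [cite: LooijengaLunts1997, §3 (3.5)] [cite: Lange2023AbelianVarietiesComplex, §2.4.4 Cor. 2.4.24] -/
theorem flat_prodForm_comp_dualProdMap (h₁ : flat κ₁ ∘ₗ P₁ = 1) (h₂ : flat κ₂ ∘ₗ P₂ = 1) :
    flat (prodForm κ₁ κ₂) ∘ₗ dualProdMap E₁ E₂ P₁ P₂ = 1 := by
  refine LinearMap.ext fun ξ ↦ ContinuousLinearMap.ext fun y ↦ ?_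
  rw [LinearMap.comp_apply, flat_prodForm, dualProdMap_apply, ContinuousLinearMap.coprod_apply, flat_apply_rinv h₁,
    flat_apply_rinv h₂, Module.End.one_apply, ContinuousLinearMap.comp_apply, ContinuousLinearMap.comp_apply,
    ContinuousLinearMap.inl_apply, ContinuousLinearMap.inr_apply, ← map_add, Prod.mk_add_mk, add_zero, zero_add]

omit [FiniteDimensional ℂ E₁] [FiniteDimensional ℂ E₂] in
/-- `(σ₁ ⊕ σ₂)(ξ₁ ∘ p₁ + ξ₂ ∘ p₂) = σ₁ξ₁ ∘ p₁ + σ₂ξ₂ ∘ p₂`. [cite: LooijengaLunts1997, §3 (3.1)] -/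
theorem dualEndProd_coprod (σ₁ : Module.End ℝ (E₁ →L[ℝ] ℝ)) (σ₂ : Module.End ℝ (E₂ →L[ℝ] ℝ)) (ξ₁ : E₁ →L[ℝ] ℝ)
    (ξ₂ : E₂ →L[ℝ] ℝ) : dualEndProd E₁ E₂ σ₁ σ₂ (ξ₁.coprod ξ₂) = (σ₁ ξ₁).coprod (σ₂ ξ₂) := by
  rw [dualEndProd_apply, ContinuousLinearMap.coprod_comp_inl, ContinuousLinearMap.coprod_comp_inr]

variable (κ₁ κ₂ P₁ P₂) in
/-- **`(a₁ × a₂)† = a₁† × a₂†`**: the adjoint for `κ₁ ⊞ κ₂` of a block-diagonal operator is block diagonal ("a direct sum of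
endomorphisms is hermitian if and only if all its summands are"). [cite: HulekLaface2019PicardNumbers, Prop. 2.2 / Cor. 2.3] [cite: LooijengaLunts1997, §3 (3.5)] -/
theorem rosatiAdj_prodMap (a₁ : Module.End ℝ E₁) (a₂ : Module.End ℝ E₂) :
    rosatiAdj (prodForm κ₁ κ₂) (dualProdMap E₁ E₂ P₁ P₂) (a₁.prodMap a₂) =
      (rosatiAdj κ₁ P₁ a₁).prodMap (rosatiAdj κ₂ P₂ a₂) := by
  refine LinearMap.ext fun x ↦ ?_
  rw [rosatiAdj, LinearMap.comp_apply, LinearMap.comp_apply, flat_prodForm, transposeEnd_prodMap, dualEndProd_coprod,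
    dualProdMap_coprod, LinearMap.prodMap_apply, rosatiAdj, rosatiAdj]
  rfl

/-- **`𝒜₁ × 𝒜₂ ⊆ End(V₁ ⊕ V₂)`**, the block-diagonal subalgebra `{a₁ × a₂ : aᵢ ∈ 𝒜ᵢ}` of two real subalgebras `𝒜ᵢ ⊆ End(Vᵢ)` — for
`Hom`-orthogonal abelian varieties `End(X₁ × X₂) ⊗ ℝ = End(X₁) ⊗ ℝ × End(X₂) ⊗ ℝ` (`endAlgReal_prodPeriod_eq`). [cite: Lange2023AbelianVarietiesComplex, §2.4.4 Cor. 2.4.26 (proof)] [cite: LooijengaLunts1997, §3 (p. 14, standard reduction: 𝔤_NS(X) = 𝔤_NS(X₁^m₁) × ⋯ × 𝔤_NS(X_k^m_k))] -/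
def prodMapSubalgebra (𝒜₁ : Subalgebra ℝ (Module.End ℝ E₁)) (𝒜₂ : Subalgebra ℝ (Module.End ℝ E₂)) :
    Subalgebra ℝ (Module.End ℝ (E₁ × E₂)) :=
  (𝒜₁.prod 𝒜₂).map (LinearMap.prodMapAlgHom ℝ E₁ E₂)

variable {𝒜₁ : Subalgebra ℝ (Module.End ℝ E₁)} {𝒜₂ : Subalgebra ℝ (Module.End ℝ E₂)}

omit [FiniteDimensional ℂ E₁] [FiniteDimensional ℂ E₂] in
/-- Membership in `𝒜₁ × 𝒜₂`: `a = a₁ × a₂` with `aᵢ ∈ 𝒜ᵢ`. [cite: Lange2023AbelianVarietiesComplex, §2.4.4 Cor. 2.4.26 (proof)] -/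
theorem mem_prodMapSubalgebra_iff {a : Module.End ℝ (E₁ × E₂)} :
    a ∈ prodMapSubalgebra 𝒜₁ 𝒜₂ ↔ ∃ a₁ ∈ 𝒜₁, ∃ a₂ ∈ 𝒜₂, a = a₁.prodMap a₂ := by
  rw [prodMapSubalgebra, Subalgebra.mem_map]
  constructor
  · rintro ⟨b, hb, rfl⟩
    exact ⟨b.1, (Subalgebra.mem_prod.1 hb).1, b.2, (Subalgebra.mem_prod.1 hb).2, rfl⟩
  · rintro ⟨a₁, h₁, a₂, h₂, rfl⟩
    exact ⟨(a₁, a₂), Subalgebra.mem_prod.2 ⟨h₁, h₂⟩, rfl⟩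

omit [FiniteDimensional ℂ E₁] [FiniteDimensional ℂ E₂] in
/-- `a₁ × a₂ ∈ 𝒜₁ × 𝒜₂` for `aᵢ ∈ 𝒜ᵢ`. [cite: Lange2023AbelianVarietiesComplex, §2.4.4 Cor. 2.4.26 (proof)] -/
theorem prodMap_mem_prodMapSubalgebra {a₁ : Module.End ℝ E₁} {a₂ : Module.End ℝ E₂} (h₁ : a₁ ∈ 𝒜₁) (h₂ : a₂ ∈ 𝒜₂) :
    a₁.prodMap a₂ ∈ prodMapSubalgebra 𝒜₁ 𝒜₂ :=
  mem_prodMapSubalgebra_iff.2 ⟨a₁, h₁, a₂, h₂, rfl⟩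

omit [FiniteDimensional ℂ E₁] [FiniteDimensional ℂ E₂] in
/-- `a₁ × a₂ ∈ 𝒜₁ × 𝒜₂ ⟺ a₁ ∈ 𝒜₁ ∧ a₂ ∈ 𝒜₂`. [cite: Lange2023AbelianVarietiesComplex, §2.4.4 Cor. 2.4.26 (proof)] -/
theorem prodMap_mem_prodMapSubalgebra_iff {a₁ : Module.End ℝ E₁} {a₂ : Module.End ℝ E₂} :
    a₁.prodMap a₂ ∈ prodMapSubalgebra 𝒜₁ 𝒜₂ ↔ a₁ ∈ 𝒜₁ ∧ a₂ ∈ 𝒜₂ := by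
  refine ⟨fun h ↦ ?_, fun h ↦ prodMap_mem_prodMapSubalgebra h.1 h.2⟩
  obtain ⟨b₁, hb₁, b₂, hb₂, h⟩ := mem_prodMapSubalgebra_iff.1 h
  obtain ⟨rfl, rfl⟩ := prodMap_eq_prodMap_iff.1 h
  exact ⟨hb₁, hb₂⟩

omit [FiniteDimensional ℂ E₁] [FiniteDimensional ℂ E₂] in
/-- `𝒜₁ × 𝒜₂` as a subspace is the image of `𝒜₁ × 𝒜₂` under `(a₁, a₂) ↦ a₁ × a₂`. [cite: Lange2023AbelianVarietiesComplex, §2.4.4 Cor. 2.4.26 (proof)] -/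
theorem prodMapSubalgebra_toSubmodule : Subalgebra.toSubmodule (prodMapSubalgebra 𝒜₁ 𝒜₂) =
    ((Subalgebra.toSubmodule 𝒜₁).prod (Subalgebra.toSubmodule 𝒜₂)).map (prodMapₗ E₁ E₂) := by
  refine Submodule.ext fun a ↦ ?_
  rw [Subalgebra.mem_toSubmodule, mem_prodMapSubalgebra_iff, Submodule.mem_map]
  constructor
  · rintro ⟨a₁, h₁, a₂, h₂, rfl⟩
    exact ⟨(a₁, a₂), Submodule.mem_prod.2 ⟨h₁, h₂⟩, rfl⟩
  · rintro ⟨b, hb, rfl⟩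
    exact ⟨b.1, (Submodule.mem_prod.1 hb).1, b.2, (Submodule.mem_prod.1 hb).2, rfl⟩

/-- **`𝒜₁ × 𝒜₂` is `†`-stable** when both `𝒜ᵢ` are. [cite: LooijengaLunts1997, §3 (3.5)] -/
theorem prodMapSubalgebra_adj (h𝒜₁ : ∀ a ∈ 𝒜₁, rosatiAdj κ₁ P₁ a ∈ 𝒜₁) (h𝒜₂ : ∀ a ∈ 𝒜₂, rosatiAdj κ₂ P₂ a ∈ 𝒜₂) :
    ∀ a ∈ prodMapSubalgebra 𝒜₁ 𝒜₂, rosatiAdj (prodForm κ₁ κ₂) (dualProdMap E₁ E₂ P₁ P₂) a ∈ prodMapSubalgebra 𝒜₁ 𝒜₂ := by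
  intro a ha
  obtain ⟨a₁, h₁, a₂, h₂, rfl⟩ := mem_prodMapSubalgebra_iff.1 ha
  rw [rosatiAdj_prodMap]
  exact prodMap_mem_prodMapSubalgebra (h𝒜₁ a₁ h₁) (h𝒜₂ a₂ h₂)

/-- `a₁ × a₂ ∈ (𝒜₁ × 𝒜₂)^+ ⟺ a₁ ∈ 𝒜₁^+ ∧ a₂ ∈ 𝒜₂^+`. [cite: LooijengaLunts1997, §3 (3.6)] [cite: HulekLaface2019PicardNumbers, Prop. 2.2 / Cor. 2.3] -/
theorem prodMap_mem_symmPart_iff {a₁ : Module.End ℝ E₁} {a₂ : Module.End ℝ E₂} :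
    a₁.prodMap a₂ ∈ symmPart (prodForm κ₁ κ₂) (dualProdMap E₁ E₂ P₁ P₂) (prodMapSubalgebra 𝒜₁ 𝒜₂) ↔
      a₁ ∈ symmPart κ₁ P₁ 𝒜₁ ∧ a₂ ∈ symmPart κ₂ P₂ 𝒜₂ := by
  rw [mem_symmPart_iff, mem_symmPart_iff, mem_symmPart_iff, prodMap_mem_prodMapSubalgebra_iff, rosatiAdj_prodMap,
    prodMap_eq_prodMap_iff]
  tauto

/-- **`(𝒜₁ × 𝒜₂)^+ = 𝒜₁^+ × 𝒜₂^+`** ("hermitian if and only if all its summands are"). [cite: LooijengaLunts1997, §3 (3.6)] [cite: HulekLaface2019PicardNumbers, Prop. 2.2 / Cor. 2.3] -/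
theorem symmPart_prod_eq : symmPart (prodForm κ₁ κ₂) (dualProdMap E₁ E₂ P₁ P₂) (prodMapSubalgebra 𝒜₁ 𝒜₂) =
    ((symmPart κ₁ P₁ 𝒜₁).prod (symmPart κ₂ P₂ 𝒜₂)).map (prodMapₗ E₁ E₂) := by
  refine Submodule.ext fun a ↦ ⟨fun ha ↦ ?_, ?_⟩
  · obtain ⟨a₁, -, a₂, -, rfl⟩ := mem_prodMapSubalgebra_iff.1 ha.1
    exact ⟨(a₁, a₂), Submodule.mem_prod.2 (prodMap_mem_symmPart_iff.1 ha), rfl⟩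
  · rintro ⟨b, hb, rfl⟩
    exact prodMap_mem_symmPart_iff.2 (Submodule.mem_prod.1 hb)

/-- Membership form of `(𝒜₁ × 𝒜₂)^+ = 𝒜₁^+ × 𝒜₂^+`. [cite: LooijengaLunts1997, §3 (3.6)] -/
theorem mem_symmPart_prod_iff {a : Module.End ℝ (E₁ × E₂)} :
    a ∈ symmPart (prodForm κ₁ κ₂) (dualProdMap E₁ E₂ P₁ P₂) (prodMapSubalgebra 𝒜₁ 𝒜₂) ↔
      ∃ a₁ ∈ symmPart κ₁ P₁ 𝒜₁, ∃ a₂ ∈ symmPart κ₂ P₂ 𝒜₂, a = a₁.prodMap a₂ := by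
  rw [symmPart_prod_eq, Submodule.mem_map]
  constructor
  · rintro ⟨b, hb, rfl⟩
    exact ⟨b.1, (Submodule.mem_prod.1 hb).1, b.2, (Submodule.mem_prod.1 hb).2, rfl⟩
  · rintro ⟨a₁, h₁, a₂, h₂, rfl⟩
    exact ⟨(a₁, a₂), Submodule.mem_prod.2 ⟨h₁, h₂⟩, rfl⟩

/-- **`S(𝒜₁ × 𝒜₂) = S₁ × S₂`**: the Lie ideal generated by the symmetric part splits (`(a₁ × a₂)(b₁ × b₂) = a₁b₁ × a₂b₂`, and
`a₁b₁ × 0 = (a₁ × 0)(b₁ × 0)` with `a₁ × 0 ∈ (𝒜₁ × 𝒜₂)^+`). [cite: LooijengaLunts1997, §3 (3.6)] -/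
theorem symmProdSpan_prod_eq : symmProdSpan (prodForm κ₁ κ₂) (dualProdMap E₁ E₂ P₁ P₂) (prodMapSubalgebra 𝒜₁ 𝒜₂) =
    ((symmProdSpan κ₁ P₁ 𝒜₁).prod (symmProdSpan κ₂ P₂ 𝒜₂)).map (prodMapₗ E₁ E₂) := by
  refine le_antisymm ?_ ?_
  · refine Submodule.span_le.2 ?_
    rintro _ ⟨a, ha, b, hb, rfl⟩
    obtain ⟨a₁, ha₁, a₂, ha₂, rfl⟩ := mem_symmPart_prod_iff.1 ha
    obtain ⟨b₁, hb₁, b₂, hb₂, rfl⟩ := mem_symmPart_prod_iff.1 hb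
    refine ⟨(a₁ * b₁, a₂ * b₂), Submodule.mem_prod.2 ⟨mul_mem_symmProdSpan ha₁ hb₁, mul_mem_symmProdSpan ha₂ hb₂⟩, ?_⟩
    rw [prodMapₗ_apply, LinearMap.prodMap_mul]
  · rw [Submodule.map_le_iff_le_comap]
    rintro c hc
    obtain ⟨hc₁, hc₂⟩ := Submodule.mem_prod.1 hc
    rw [Submodule.mem_comap, prodMapₗ_apply,
      show c.1.prodMap c.2 = c.1.prodMap (0 : Module.End ℝ E₂) + (0 : Module.End ℝ E₁).prodMap c.2 by
        rw [← LinearMap.prodMap_add, add_zero, zero_add]]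
    refine Submodule.add_mem _ ?_ ?_
    · have key : symmProdSpan κ₁ P₁ 𝒜₁ ≤
          (symmProdSpan (prodForm κ₁ κ₂) (dualProdMap E₁ E₂ P₁ P₂) (prodMapSubalgebra 𝒜₁ 𝒜₂)).comap
            (prodMapₗ E₁ E₂ ∘ₗ LinearMap.inl ℝ (Module.End ℝ E₁) (Module.End ℝ E₂)) := by
        refine Submodule.span_le.2 ?_
        rintro _ ⟨a, ha, b, hb, rfl⟩
        rw [SetLike.mem_coe, Submodule.mem_comap, LinearMap.comp_apply, LinearMap.inl_apply, prodMapₗ_apply,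
          show (a * b).prodMap (0 : Module.End ℝ E₂) = a.prodMap (0 : Module.End ℝ E₂) * b.prodMap 0 by
            rw [LinearMap.prodMap_mul, mul_zero]]
        exact mul_mem_symmProdSpan (prodMap_mem_symmPart_iff.2 ⟨ha, Submodule.zero_mem _⟩)
          (prodMap_mem_symmPart_iff.2 ⟨hb, Submodule.zero_mem _⟩)
      exact key hc₁
    · have key : symmProdSpan κ₂ P₂ 𝒜₂ ≤
          (symmProdSpan (prodForm κ₁ κ₂) (dualProdMap E₁ E₂ P₁ P₂) (prodMapSubalgebra 𝒜₁ 𝒜₂)).comap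
            (prodMapₗ E₁ E₂ ∘ₗ LinearMap.inr ℝ (Module.End ℝ E₁) (Module.End ℝ E₂)) := by
        refine Submodule.span_le.2 ?_
        rintro _ ⟨a, ha, b, hb, rfl⟩
        rw [SetLike.mem_coe, Submodule.mem_comap, LinearMap.comp_apply, LinearMap.inr_apply, prodMapₗ_apply,
          show (0 : Module.End ℝ E₁).prodMap (a * b) = (0 : Module.End ℝ E₁).prodMap a * (0 : Module.End ℝ E₁).prodMap b by
            rw [LinearMap.prodMap_mul, mul_zero]]
        exact mul_mem_symmProdSpan (prodMap_mem_symmPart_iff.2 ⟨Submodule.zero_mem _, ha⟩)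
          (prodMap_mem_symmPart_iff.2 ⟨Submodule.zero_mem _, hb⟩)
      exact key hc₂

/-- Membership form of `S(𝒜₁ × 𝒜₂) = S₁ × S₂`. [cite: LooijengaLunts1997, §3 (3.6)] -/
theorem mem_symmProdSpan_prod_iff {c : Module.End ℝ (E₁ × E₂)} :
    c ∈ symmProdSpan (prodForm κ₁ κ₂) (dualProdMap E₁ E₂ P₁ P₂) (prodMapSubalgebra 𝒜₁ 𝒜₂) ↔
      ∃ c₁ ∈ symmProdSpan κ₁ P₁ 𝒜₁, ∃ c₂ ∈ symmProdSpan κ₂ P₂ 𝒜₂, c = c₁.prodMap c₂ := by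
  rw [symmProdSpan_prod_eq, Submodule.mem_map]
  constructor
  · rintro ⟨b, hb, rfl⟩
    exact ⟨b.1, (Submodule.mem_prod.1 hb).1, b.2, (Submodule.mem_prod.1 hb).2, rfl⟩
  · rintro ⟨a₁, h₁, a₂, h₂, rfl⟩
    exact ⟨(a₁, a₂), Submodule.mem_prod.2 ⟨h₁, h₂⟩, rfl⟩

/-! #### The three pieces and the model of block-diagonal data -/

/-- **The degree-`2` piece splits**: `ψ₂((κ₁ ⊞ κ₂)(𝒜₁ × 𝒜₂)^+) = sumDualBlockDiag(ψ₂(κ₁𝒜₁^+) × ψ₂(κ₂𝒜₂^+))`. [cite: LooijengaLunts1997, §3 (3.6)] [cite: LooijengaLunts1997, §1 (p. 4, exterior direct sum and tensor product)] -/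
theorem upPiece_prod_eq : upPiece (prodForm κ₁ κ₂) (dualProdMap E₁ E₂ P₁ P₂) (prodMapSubalgebra 𝒜₁ 𝒜₂) =
    ((upPiece κ₁ P₁ 𝒜₁).prod (upPiece κ₂ P₂ 𝒜₂)).map (sumDualBlockDiag E₁ E₂).toLinearMap := by
  have hc : upMap (prodForm κ₁ κ₂) ∘ₗ prodMapₗ E₁ E₂ =
      (sumDualBlockDiag E₁ E₂).toLinearMap ∘ₗ (upMap κ₁).prodMap (upMap κ₂) :=
    LinearMap.ext fun a ↦ by
      rw [LinearMap.comp_apply, prodMapₗ_apply, LinearMap.comp_apply, LinearMap.prodMap_apply, AlgHom.toLinearMap_apply,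
        sumDualBlockDiag_upMap]
  rw [upPiece, symmPart_prod_eq, ← Submodule.map_comp, hc, Submodule.map_comp, map_prodMap_prod]
  rfl

/-- **The degree-`-2` piece splits**: `ψ₋₂((𝒜₁ × 𝒜₂)^+(κ₁ ⊞ κ₂)⁻¹) = sumDualBlockDiag(ψ₋₂(𝒜₁^+κ₁⁻¹) × ψ₋₂(𝒜₂^+κ₂⁻¹))`. [cite: LooijengaLunts1997, §3 (3.6)] [cite: LooijengaLunts1997, §1 (p. 4, exterior direct sum and tensor product)] -/
theorem lowPiece_prod_eq : lowPiece (prodForm κ₁ κ₂) (dualProdMap E₁ E₂ P₁ P₂) (prodMapSubalgebra 𝒜₁ 𝒜₂) =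
    ((lowPiece κ₁ P₁ 𝒜₁).prod (lowPiece κ₂ P₂ 𝒜₂)).map (sumDualBlockDiag E₁ E₂).toLinearMap := by
  have hc : lowMap (dualProdMap E₁ E₂ P₁ P₂) ∘ₗ prodMapₗ E₁ E₂ =
      (sumDualBlockDiag E₁ E₂).toLinearMap ∘ₗ (lowMap P₁).prodMap (lowMap P₂) :=
    LinearMap.ext fun a ↦ by
      rw [LinearMap.comp_apply, prodMapₗ_apply, LinearMap.comp_apply, LinearMap.prodMap_apply, AlgHom.toLinearMap_apply,
        sumDualBlockDiag_lowMap]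
  rw [lowPiece, symmPart_prod_eq, ← Submodule.map_comp, hc, Submodule.map_comp, map_prodMap_prod]
  rfl

/-- **The degree-`0` piece splits**: `ψ₀(S(𝒜₁ × 𝒜₂)^*) = sumDualBlockDiag(ψ₀(S₁^*) × ψ₀(S₂^*))`. [cite: LooijengaLunts1997, §3 (3.6)] [cite: LooijengaLunts1997, §1 (p. 4, exterior direct sum and tensor product)] -/
theorem midPiece_prod_eq : midPiece (prodForm κ₁ κ₂) (dualProdMap E₁ E₂ P₁ P₂) (prodMapSubalgebra 𝒜₁ 𝒜₂) =
    ((midPiece κ₁ P₁ 𝒜₁).prod (midPiece κ₂ P₂ 𝒜₂)).map (sumDualBlockDiag E₁ E₂).toLinearMap := by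
  have hc : midMap (E₁ × E₂) ∘ₗ prodMapₗ E₁ E₂ =
      (sumDualBlockDiag E₁ E₂).toLinearMap ∘ₗ (midMap E₁).prodMap (midMap E₂) :=
    LinearMap.ext fun a ↦ by
      rw [LinearMap.comp_apply, prodMapₗ_apply, LinearMap.comp_apply, LinearMap.prodMap_apply, AlgHom.toLinearMap_apply,
        sumDualBlockDiag_midMap]
  rw [midPiece, symmProdSpan_prod_eq, ← Submodule.map_comp, hc, Submodule.map_comp, map_prodMap_prod]
  rfl

/-- **The model of block-diagonal data is the block-diagonal product of the models**:
`model(κ₁ ⊞ κ₂, P₁ ⊕ P₂, 𝒜₁ × 𝒜₂) = sumDualBlockDiag(model(κ₁, P₁, 𝒜₁) × model(κ₂, P₂, 𝒜₂))`. [cite: LooijengaLunts1997, §1 (p. 4, exterior direct sum and tensor product)] [cite: LooijengaLunts1997, §3 (p. 14, standard reduction: 𝔤_NS(X) = 𝔤_NS(X₁^m₁) × ⋯ × 𝔤_NS(X_k^m_k))] -/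
theorem model_prod_eq : model (prodForm κ₁ κ₂) (dualProdMap E₁ E₂ P₁ P₂) (prodMapSubalgebra 𝒜₁ 𝒜₂) =
    ((model κ₁ P₁ 𝒜₁).prod (model κ₂ P₂ 𝒜₂)).map (sumDualBlockDiag E₁ E₂).toLinearMap := by
  rw [model, lowPiece_prod_eq, midPiece_prod_eq, upPiece_prod_eq, ← Submodule.map_sup, ← Submodule.map_sup,
    Submodule.prod_sup_prod, Submodule.prod_sup_prod, model, model]

/-- Membership form of `model_prod_eq`: `T = sumDualBlockDiag(x₁, x₂)` with `xᵢ ∈ modelᵢ`. [cite: LooijengaLunts1997, §1 (p. 4, exterior direct sum and tensor product)] -/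
theorem mem_model_prod_iff {T : Module.End ℝ (sumDual (E₁ × E₂))} :
    T ∈ model (prodForm κ₁ κ₂) (dualProdMap E₁ E₂ P₁ P₂) (prodMapSubalgebra 𝒜₁ 𝒜₂) ↔
      ∃ x₁ ∈ model κ₁ P₁ 𝒜₁, ∃ x₂ ∈ model κ₂ P₂ 𝒜₂, T = sumDualBlockDiag E₁ E₂ (x₁, x₂) := by
  rw [model_prod_eq, Submodule.mem_map]
  constructor
  · rintro ⟨b, hb, rfl⟩
    exact ⟨b.1, (Submodule.mem_prod.1 hb).1, b.2, (Submodule.mem_prod.1 hb).2, rfl⟩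
  · rintro ⟨a₁, h₁, a₂, h₂, rfl⟩
    exact ⟨(a₁, a₂), Submodule.mem_prod.2 ⟨h₁, h₂⟩, rfl⟩

/-- `sumDualBlockDiag(x₁, x₂) ∈ model(𝒜₁ × 𝒜₂) ⟺ x₁ ∈ model₁ ∧ x₂ ∈ model₂`. [cite: LooijengaLunts1997, §1 (p. 4, exterior direct sum and tensor product)] -/
theorem sumDualBlockDiag_mem_model_prod_iff {x₁ : Module.End ℝ (sumDual E₁)} {x₂ : Module.End ℝ (sumDual E₂)} :
    sumDualBlockDiag E₁ E₂ (x₁, x₂) ∈ model (prodForm κ₁ κ₂) (dualProdMap E₁ E₂ P₁ P₂) (prodMapSubalgebra 𝒜₁ 𝒜₂) ↔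
      x₁ ∈ model κ₁ P₁ 𝒜₁ ∧ x₂ ∈ model κ₂ P₂ 𝒜₂ := by
  rw [mem_model_prod_iff]
  refine ⟨fun ⟨y₁, h₁, y₂, h₂, h⟩ ↦ ?_, fun h ↦ ⟨x₁, h.1, x₂, h.2, rfl⟩⟩
  obtain ⟨rfl, rfl⟩ := Prod.mk.inj (sumDualBlockDiag_injective h)
  exact ⟨h₁, h₂⟩

end BlockData


/-! ### §3 `𝔤(𝔞′ × 𝔞″, M′ ⊠ M″) = 𝔤(𝔞′, M′) × 𝔤(𝔞″, M″)`: the model, `llModel` and `𝔤(𝔞(𝒜))` of block-diagonal data -/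

section LieProd

variable {R : Type*} {L₁ L₂ L₁' L₂' : Type*} [CommRing R] [LieRing L₁] [LieAlgebra R L₁] [LieRing L₂] [LieAlgebra R L₂]
  [LieRing L₁'] [LieAlgebra R L₁'] [LieRing L₂'] [LieAlgebra R L₂']

/-- `L₁ ≃ L₁'` and `L₂ ≃ L₂'` give `L₁ × L₂ ≃ L₁' × L₂'` (Lie algebras; Mathlib's `Algebra.Lie.Prod` lists Lie equivalences of products as a
TODO, so it is assembled here from `LieHom.prodMap`). [cite: Bourbaki1989LieGroups13, Ch. I §1.1 (product of Lie algebras)] [cite: LooijengaLunts1997, §1 (p. 4, exterior direct sum and tensor product)] -/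
def lieEquivProdCongr (e₁ : L₁ ≃ₗ⁅R⁆ L₁') (e₂ : L₂ ≃ₗ⁅R⁆ L₂') : (L₁ × L₂) ≃ₗ⁅R⁆ (L₁' × L₂') :=
  { (e₁ : L₁ →ₗ⁅R⁆ L₁').prodMap (e₂ : L₂ →ₗ⁅R⁆ L₂') with
    invFun := fun x ↦ (e₁.symm x.1, e₂.symm x.2)
    left_inv := fun x ↦ Prod.ext (e₁.symm_apply_apply x.1) (e₂.symm_apply_apply x.2)
    right_inv := fun x ↦ Prod.ext (e₁.apply_symm_apply x.1) (e₂.apply_symm_apply x.2) }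

/-- unfolding of `lieEquivProdCongr` (definitional). [cite: LooijengaLunts1997, §1 (p. 4, exterior direct sum and tensor product)] -/
@[simp]
theorem lieEquivProdCongr_apply (e₁ : L₁ ≃ₗ⁅R⁆ L₁') (e₂ : L₂ ≃ₗ⁅R⁆ L₂') (x : L₁ × L₂) :
    lieEquivProdCongr e₁ e₂ x = (e₁ x.1, e₂ x.2) := rfl

/-- unfolding of the inverse of `lieEquivProdCongr` (definitional). [cite: LooijengaLunts1997, §1 (p. 4, exterior direct sum and tensor product)] -/
@[simp]
theorem lieEquivProdCongr_symm_apply (e₁ : L₁ ≃ₗ⁅R⁆ L₁') (e₂ : L₂ ≃ₗ⁅R⁆ L₂') (x : L₁' × L₂') :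
    (lieEquivProdCongr e₁ e₂).symm x = (e₁.symm x.1, e₂.symm x.2) := rfl

end LieProd

section ModelProd

variable {E₁ E₂ : Type*} [NormedAddCommGroup E₁] [NormedSpace ℂ E₁] [NormedAddCommGroup E₂] [NormedSpace ℂ E₂]
  [FiniteDimensional ℂ E₁] [FiniteDimensional ℂ E₂]
  {κ₁ : E₁ [⋀^Fin 2]→L[ℝ] ℝ} {κ₂ : E₂ [⋀^Fin 2]→L[ℝ] ℝ} {P₁ : (E₁ →L[ℝ] ℝ) →ₗ[ℝ] E₁} {P₂ : (E₂ →L[ℝ] ℝ) →ₗ[ℝ] E₂}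
  {𝒜₁ : Subalgebra ℝ (Module.End ℝ E₁)} {𝒜₂ : Subalgebra ℝ (Module.End ℝ E₂)}
  (h₁ : flat κ₁ ∘ₗ P₁ = 1) (h₂ : flat κ₂ ∘ₗ P₂ = 1)
  (h𝒜₁ : ∀ a ∈ 𝒜₁, rosatiAdj κ₁ P₁ a ∈ 𝒜₁) (h𝒜₂ : ∀ a ∈ 𝒜₂, rosatiAdj κ₂ P₂ a ∈ 𝒜₂)
  (h : flat (prodForm κ₁ κ₂) ∘ₗ dualProdMap E₁ E₂ P₁ P₂ = 1)
  (h𝒜 : ∀ a ∈ prodMapSubalgebra 𝒜₁ 𝒜₂, rosatiAdj (prodForm κ₁ κ₂) (dualProdMap E₁ E₂ P₁ P₂) a ∈ prodMapSubalgebra 𝒜₁ 𝒜₂)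

/-- **`modelLie 𝒜₁ × modelLie 𝒜₂ → 𝔤𝔩((V₁ ⊕ V₂) ⊕ (V₁ ⊕ V₂)^*)`, `(x₁, x₂) ↦ sumDualBlockDiag(x₁, x₂)`**, a Lie algebra homomorphism
(the block-diagonal embedding is multiplicative). [cite: LooijengaLunts1997, §1 (p. 4, exterior direct sum and tensor product)] -/
def modelLieProdHom :
    (modelLie κ₁ P₁ 𝒜₁ h₁ h𝒜₁ × modelLie κ₂ P₂ 𝒜₂ h₂ h𝒜₂) →ₗ⁅ℝ⁆ Module.End ℝ (sumDual (E₁ × E₂)) where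
  toFun x := sumDualBlockDiag E₁ E₂ ((x.1 : Module.End ℝ (sumDual E₁)), (x.2 : Module.End ℝ (sumDual E₂)))
  map_add' x y := by
    change sumDualBlockDiag E₁ E₂ ((x.1 : Module.End ℝ (sumDual E₁)) + y.1, (x.2 : Module.End ℝ (sumDual E₂)) + y.2) = _
    rw [← Prod.mk_add_mk, map_add]
  map_smul' c x := by
    change sumDualBlockDiag E₁ E₂ (c • (x.1 : Module.End ℝ (sumDual E₁)), c • (x.2 : Module.End ℝ (sumDual E₂))) = _
    rw [← Prod.smul_mk, map_smul, RingHom.id_apply]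
  map_lie' {x y} := by
    change sumDualBlockDiag E₁ E₂ ((x.1 : Module.End ℝ (sumDual E₁)) * y.1 - y.1 * x.1,
        (x.2 : Module.End ℝ (sumDual E₂)) * y.2 - y.2 * x.2) =
      sumDualBlockDiag E₁ E₂ (x.1, x.2) * sumDualBlockDiag E₁ E₂ (y.1, y.2) - sumDualBlockDiag E₁ E₂ (y.1, y.2) * sumDualBlockDiag E₁ E₂ (x.1, x.2)
    rw [← map_mul, ← map_mul, ← map_sub (sumDualBlockDiag E₁ E₂)]
    rfl

/-- unfolding of `modelLieProdHom` (definitional). [cite: LooijengaLunts1997, §1 (p. 4, exterior direct sum and tensor product)] -/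
theorem modelLieProdHom_apply (x : modelLie κ₁ P₁ 𝒜₁ h₁ h𝒜₁ × modelLie κ₂ P₂ 𝒜₂ h₂ h𝒜₂) :
    modelLieProdHom h₁ h₂ h𝒜₁ h𝒜₂ x =
      sumDualBlockDiag E₁ E₂ ((x.1 : Module.End ℝ (sumDual E₁)), (x.2 : Module.End ℝ (sumDual E₂))) :=
  rfl

/-- `modelLieProdHom` is injective. [cite: LooijengaLunts1997, §1 (p. 4, exterior direct sum and tensor product)] -/
theorem modelLieProdHom_injective : Injective (modelLieProdHom h₁ h₂ h𝒜₁ h𝒜₂) := by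
  intro x y hxy
  obtain ⟨e₁, e₂⟩ := Prod.mk.inj (sumDualBlockDiag_injective hxy)
  exact Prod.ext (Subtype.ext e₁) (Subtype.ext e₂)

include h h𝒜 in
/-- **The range of `modelLieProdHom` is the model of the block-diagonal data** (`model_prod_eq`). [cite: LooijengaLunts1997, §1 (p. 4, exterior direct sum and tensor product)] -/
theorem range_modelLieProdHom : ((modelLieProdHom h₁ h₂ h𝒜₁ h𝒜₂).range : Set (Module.End ℝ (sumDual (E₁ × E₂)))) =
    modelLie (prodForm κ₁ κ₂) (dualProdMap E₁ E₂ P₁ P₂) (prodMapSubalgebra 𝒜₁ 𝒜₂) h h𝒜 := by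
  ext T
  rw [SetLike.mem_coe, SetLike.mem_coe, LieHom.mem_range, mem_modelLie_iff, mem_model_prod_iff]
  constructor
  · rintro ⟨x, rfl⟩
    exact ⟨x.1, x.1.2, x.2, x.2.2, rfl⟩
  · rintro ⟨x₁, hx₁, x₂, hx₂, rfl⟩
    exact ⟨(⟨x₁, hx₁⟩, ⟨x₂, hx₂⟩), rfl⟩

/-- **`modelLie(κ₁ ⊞ κ₂, P₁ ⊕ P₂, 𝒜₁ × 𝒜₂) ≃ₗ⁅ℝ⁆ modelLie(κ₁, P₁, 𝒜₁) × modelLie(κ₂, P₂, 𝒜₂)`** — the model of block-diagonal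
data IS the product Lie algebra of the models ("the associated Lie algebra is … equal to `𝔤(𝔞′, M′) × 𝔤(𝔞″, M″)`", at the
level of `𝔰𝔬(V ⊕ V^*)`). [cite: LooijengaLunts1997, §1 (p. 4, exterior direct sum and tensor product)] [cite: LooijengaLunts1997, §3 (p. 14, standard reduction: 𝔤_NS(X) = 𝔤_NS(X₁^m₁) × ⋯ × 𝔤_NS(X_k^m_k))] -/
def modelLieProdEquiv : modelLie (prodForm κ₁ κ₂) (dualProdMap E₁ E₂ P₁ P₂) (prodMapSubalgebra 𝒜₁ 𝒜₂) h h𝒜 ≃ₗ⁅ℝ⁆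
    (modelLie κ₁ P₁ 𝒜₁ h₁ h𝒜₁ × modelLie κ₂ P₂ 𝒜₂ h₂ h𝒜₂) :=
  ((LieEquiv.ofInjective _ (modelLieProdHom_injective h₁ h₂ h𝒜₁ h𝒜₂)).trans
    (LieEquiv.ofEq _ _ (range_modelLieProdHom h₁ h₂ h𝒜₁ h𝒜₂ h h𝒜))).symm

/-- The inverse of `modelLieProdEquiv` is `(x₁, x₂) ↦ sumDualBlockDiag(x₁, x₂)`. [cite: LooijengaLunts1997, §1 (p. 4, exterior direct sum and tensor product)] -/
theorem coe_modelLieProdEquiv_symm_apply (x : modelLie κ₁ P₁ 𝒜₁ h₁ h𝒜₁ × modelLie κ₂ P₂ 𝒜₂ h₂ h𝒜₂) :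
    (((modelLieProdEquiv h₁ h₂ h𝒜₁ h𝒜₂ h h𝒜).symm x :
        modelLie (prodForm κ₁ κ₂) (dualProdMap E₁ E₂ P₁ P₂) (prodMapSubalgebra 𝒜₁ 𝒜₂) h h𝒜) :
      Module.End ℝ (sumDual (E₁ × E₂))) =
      sumDualBlockDiag E₁ E₂ ((x.1 : Module.End ℝ (sumDual E₁)), (x.2 : Module.End ℝ (sumDual E₂))) := by
  rw [modelLieProdEquiv, LieEquiv.symm_symm]
  rfl

/-- `modelLieProdEquiv (sumDualBlockDiag(x₁, x₂)) = (x₁, x₂)`. [cite: LooijengaLunts1997, §1 (p. 4, exterior direct sum and tensor product)] -/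
theorem modelLieProdEquiv_apply_mk (x : modelLie κ₁ P₁ 𝒜₁ h₁ h𝒜₁ × modelLie κ₂ P₂ 𝒜₂ h₂ h𝒜₂)
    (hx : sumDualBlockDiag E₁ E₂ ((x.1 : Module.End ℝ (sumDual E₁)), (x.2 : Module.End ℝ (sumDual E₂))) ∈
      modelLie (prodForm κ₁ κ₂) (dualProdMap E₁ E₂ P₁ P₂) (prodMapSubalgebra 𝒜₁ 𝒜₂) h h𝒜) :
    modelLieProdEquiv h₁ h₂ h𝒜₁ h𝒜₂ h h𝒜 ⟨_, hx⟩ = x := by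
  have e : (modelLieProdEquiv h₁ h₂ h𝒜₁ h𝒜₂ h h𝒜).symm x = ⟨_, hx⟩ :=
    Subtype.ext (coe_modelLieProdEquiv_symm_apply h₁ h₂ h𝒜₁ h𝒜₂ h h𝒜 x)
  rw [← e, LieEquiv.apply_symm_apply]

/-! #### `llModel` and `𝔤(𝔞(𝒜))` of block-diagonal data -/

/-- `modelEquivLLModel x = ρ(x)` (row A1-54's isomorphism of the model onto `llModel` is the spinor representation; definitional).
[cite: LooijengaLunts1997, §3 (3.2), (3.6)] -/
theorem coe_modelEquivLLModel_apply {E : Type*} [NormedAddCommGroup E] [NormedSpace ℂ E] [FiniteDimensional ℂ E]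
    {κ : E [⋀^Fin 2]→L[ℝ] ℝ} {P₀ : (E →L[ℝ] ℝ) →ₗ[ℝ] E} {𝒜 : Subalgebra ℝ (Module.End ℝ E)} (h₁ : flat κ ∘ₗ P₀ = 1)
    (h𝒜 : ∀ a ∈ 𝒜, rosatiAdj κ P₀ a ∈ 𝒜) (x : modelLie κ P₀ 𝒜 h₁ h𝒜) :
    ((modelEquivLLModel h₁ h𝒜 x : llModel h₁ h𝒜) : Module.End ℂ (GForm E ℂ)) =
      spinorRepLin E (x : Module.End ℝ (sumDual E)) :=
  rfl

/-- **`llModel(κ₁ ⊞ κ₂, P₁ ⊕ P₂, 𝒜₁ × 𝒜₂) ≃ₗ⁅ℝ⁆ llModel(κ₁, P₁, 𝒜₁) × llModel(κ₂, P₂, 𝒜₂)`** — the images of the models under the three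
spinor representations `ρ` (of `V₁ ⊕ V₂`), `ρ₁`, `ρ₂`: `ρ(sumDualBlockDiag(x₁, x₂)) ↦ (ρ₁ x₁, ρ₂ x₂)`
(`llModelProdEquiv_apply_of_eq`).  "`M′ ⊠ M″`" is read through the spinor representations, not through a Künneth isomorphism. [cite: LooijengaLunts1997, §1 (p. 4, exterior direct sum and tensor product)] -/
def llModelProdEquiv : llModel h h𝒜 ≃ₗ⁅ℝ⁆ (llModel h₁ h𝒜₁ × llModel h₂ h𝒜₂) :=
  (modelEquivLLModel h h𝒜).symm.trans
    ((modelLieProdEquiv h₁ h₂ h𝒜₁ h𝒜₂ h h𝒜).trans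
      (lieEquivProdCongr (modelEquivLLModel h₁ h𝒜₁) (modelEquivLLModel h₂ h𝒜₂)))

set_option maxHeartbeats 400000 in
/-- The inverse of `llModelProdEquiv`: `(ρ₁ x₁, ρ₂ x₂) ↦ ρ(sumDualBlockDiag(x₁, x₂))`. [cite: LooijengaLunts1997, §1 (p. 4, exterior direct sum and tensor product)] -/
theorem llModelProdEquiv_symm_apply_coe (y : llModel h₁ h𝒜₁ × llModel h₂ h𝒜₂) (x₁ : modelLie κ₁ P₁ 𝒜₁ h₁ h𝒜₁)
    (x₂ : modelLie κ₂ P₂ 𝒜₂ h₂ h𝒜₂) (hy₁ : (y.1 : Module.End ℂ (GForm E₁ ℂ)) = spinorRepLin E₁ (x₁ : Module.End ℝ (sumDual E₁)))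
    (hy₂ : (y.2 : Module.End ℂ (GForm E₂ ℂ)) = spinorRepLin E₂ (x₂ : Module.End ℝ (sumDual E₂))) :
    (((llModelProdEquiv h₁ h₂ h𝒜₁ h𝒜₂ h h𝒜).symm y : llModel h h𝒜) : Module.End ℂ (GForm (E₁ × E₂) ℂ)) =
      spinorRepLin (E₁ × E₂) (sumDualBlockDiag E₁ E₂ ((x₁ : Module.End ℝ (sumDual E₁)), (x₂ : Module.End ℝ (sumDual E₂)))) := by
  have e₁ : y.1 = modelEquivLLModel h₁ h𝒜₁ x₁ := Subtype.ext (by rw [coe_modelEquivLLModel_apply]; exact hy₁)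
  have e₂ : y.2 = modelEquivLLModel h₂ h𝒜₂ x₂ := Subtype.ext (by rw [coe_modelEquivLLModel_apply]; exact hy₂)
  have ey : y = (modelEquivLLModel h₁ h𝒜₁ x₁, modelEquivLLModel h₂ h𝒜₂ x₂) := Prod.ext e₁ e₂
  rw [ey, llModelProdEquiv, LieEquiv.symm_trans, LieEquiv.symm_trans, LieEquiv.trans_apply, LieEquiv.trans_apply,
    lieEquivProdCongr_symm_apply, LieEquiv.symm_apply_apply, LieEquiv.symm_apply_apply, LieEquiv.symm_symm,
    coe_modelEquivLLModel_apply, coe_modelLieProdEquiv_symm_apply]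

/-- **`llModelProdEquiv (ρ(sumDualBlockDiag(x₁, x₂))) = (ρ₁ x₁, ρ₂ x₂)`** for `xᵢ ∈ modelᵢ`. [cite: LooijengaLunts1997, §1 (p. 4, exterior direct sum and tensor product)] -/
theorem llModelProdEquiv_apply_of_eq {T : llModel h h𝒜} {x₁ : Module.End ℝ (sumDual E₁)} {x₂ : Module.End ℝ (sumDual E₂)}
    (hx₁ : x₁ ∈ model κ₁ P₁ 𝒜₁) (hx₂ : x₂ ∈ model κ₂ P₂ 𝒜₂)
    (hT : (T : Module.End ℂ (GForm (E₁ × E₂) ℂ)) = spinorRepLin (E₁ × E₂) (sumDualBlockDiag E₁ E₂ (x₁, x₂))) :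
    ((llModelProdEquiv h₁ h₂ h𝒜₁ h𝒜₂ h h𝒜 T).1 : Module.End ℂ (GForm E₁ ℂ)) = spinorRepLin E₁ x₁ ∧
      ((llModelProdEquiv h₁ h₂ h𝒜₁ h𝒜₂ h h𝒜 T).2 : Module.End ℂ (GForm E₂ ℂ)) = spinorRepLin E₂ x₂ := by
  set y : llModel h₁ h𝒜₁ × llModel h₂ h𝒜₂ :=
    (modelEquivLLModel h₁ h𝒜₁ ⟨x₁, hx₁⟩, modelEquivLLModel h₂ h𝒜₂ ⟨x₂, hx₂⟩) with hy
  have key : (llModelProdEquiv h₁ h₂ h𝒜₁ h𝒜₂ h h𝒜).symm y = T := Subtype.ext (by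
    rw [llModelProdEquiv_symm_apply_coe h₁ h₂ h𝒜₁ h𝒜₂ h h𝒜 y ⟨x₁, hx₁⟩ ⟨x₂, hx₂⟩ rfl rfl, hT])
  rw [← key, LieEquiv.apply_symm_apply]
  exact ⟨rfl, rfl⟩

variable [Nontrivial E₁] [Nontrivial E₂]

/-- **LL §1, "the associated Lie algebra is … `𝔤(𝔞′, M′) × 𝔤(𝔞″, M″)` … in the second case [`M′ ⊠ M″`] if both factors are
nonzero", for the tree's Lefschetz modules `(𝔞(𝒜ᵢ), H•(Xᵢ; ℂ))`**: `𝔤(𝔞(𝒜₁ × 𝒜₂), H•(X₁ × X₂; ℂ)) ≃ₗ⁅ℝ⁆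
𝔤(𝔞(𝒜₁), H•(X₁; ℂ)) × 𝔤(𝔞(𝒜₂), H•(X₂; ℂ))` (`llAlgebra … (formsOf …)` = the real Lie subalgebra of `𝔤𝔩(H•(X; ℂ))` generated by the
`e_a`, `f_a`, `a ∈ 𝔞(𝒜)`; `dim Vᵢ ≥ 1` is the printed "both factors are nonzero"). [cite: LooijengaLunts1997, §1 (p. 4, exterior direct sum and tensor product)] -/
def llAlgebraFormsOfProdEquiv :
    llAlgebra (E₁ × E₂) (formsOf (dualProdMap E₁ E₂ P₁ P₂) (prodMapSubalgebra 𝒜₁ 𝒜₂)) ≃ₗ⁅ℝ⁆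
      (llAlgebra E₁ (formsOf P₁ 𝒜₁) × llAlgebra E₂ (formsOf P₂ 𝒜₂)) :=
  (LieEquiv.ofEq _ _ (congrArg SetLike.coe (llAlgebra_formsOf_eq h h𝒜))).trans
    ((llModelProdEquiv h₁ h₂ h𝒜₁ h𝒜₂ h h𝒜).trans
      (lieEquivProdCongr (LieEquiv.ofEq _ _ (congrArg SetLike.coe (llAlgebra_formsOf_eq h₁ h𝒜₁).symm))
        (LieEquiv.ofEq _ _ (congrArg SetLike.coe (llAlgebra_formsOf_eq h₂ h𝒜₂).symm))))

end ModelProd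


/-! ### §4 `𝔞(𝒜₁ × 𝒜₂) = p₁^*𝔞(𝒜₁) ⊕ p₂^*𝔞(𝒜₂)`: the forms of block-diagonal data -/

section FormsProd

variable {E₁ E₂ : Type*} [NormedAddCommGroup E₁] [NormedSpace ℂ E₁] [NormedAddCommGroup E₂] [NormedSpace ℂ E₂]
  [FiniteDimensional ℂ E₁] [FiniteDimensional ℂ E₂]
  {P₁ : (E₁ →L[ℝ] ℝ) →ₗ[ℝ] E₁} {P₂ : (E₂ →L[ℝ] ℝ) →ₗ[ℝ] E₂}
  {𝒜₁ : Subalgebra ℝ (Module.End ℝ E₁)} {𝒜₂ : Subalgebra ℝ (Module.End ℝ E₂)}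

omit [FiniteDimensional ℂ E₁] [FiniteDimensional ℂ E₂] in
/-- Two `2`-forms agreeing on all pairs are equal (plumbing). [folklore] -/
private theorem twoForm_ext₂ {F : Type*} [NormedAddCommGroup F] [NormedSpace ℂ F] {κ κ' : F [⋀^Fin 2]→L[ℝ] ℝ}
    (hκ : ∀ x y : F, κ ![x, y] = κ' ![x, y]) : κ = κ' := by
  ext v
  have e : v = ![v 0, v 1] := by
    funext i
    fin_cases i <;> rfl
  rw [e]
  exact hκ _ _

variable (P₁ P₂) in
/-- **`σ_{a₁ ⊞ a₂} = σ_{a₁} × σ_{a₂}`**: the endomorphism of a product form is block diagonal ("`f = (f_1, …, f_r)` where `f_i : A_i^{n_i} → (A_i^{n_i})^∨`"). [cite: HulekLaface2019PicardNumbers, Prop. 2.2 / Cor. 2.3] [cite: LooijengaLunts1997, §3 (3.5)] -/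
theorem sigmaMap_prodForm (a₁ : E₁ [⋀^Fin 2]→L[ℝ] ℝ) (a₂ : E₂ [⋀^Fin 2]→L[ℝ] ℝ) :
    sigmaMap (dualProdMap E₁ E₂ P₁ P₂) (prodForm a₁ a₂) = (sigmaMap P₁ a₁).prodMap (sigmaMap P₂ a₂) := by
  refine LinearMap.ext fun x ↦ ?_
  rw [sigmaMap_apply, LinearMap.comp_apply, flat_prodForm, dualProdMap_coprod, LinearMap.prodMap_apply, sigmaMap_apply,
    sigmaMap_apply]
  rfl

/-- **`a₁ ⊞ a₂ ∈ 𝔞(𝒜₁ × 𝒜₂) ⟺ a₁ ∈ 𝔞(𝒜₁) ∧ a₂ ∈ 𝔞(𝒜₂)`**. [cite: HulekLaface2019PicardNumbers, Prop. 2.2 / Cor. 2.3] [cite: LooijengaLunts1997, §3 (3.5)] -/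
theorem prodForm_mem_formsOf_iff {a₁ : E₁ [⋀^Fin 2]→L[ℝ] ℝ} {a₂ : E₂ [⋀^Fin 2]→L[ℝ] ℝ} :
    prodForm a₁ a₂ ∈ formsOf (dualProdMap E₁ E₂ P₁ P₂) (prodMapSubalgebra 𝒜₁ 𝒜₂) ↔ a₁ ∈ formsOf P₁ 𝒜₁ ∧ a₂ ∈ formsOf P₂ 𝒜₂ := by
  rw [mem_formsOf_iff, mem_formsOf_iff, mem_formsOf_iff, ← sigmaMap_apply, ← sigmaMap_apply, ← sigmaMap_apply,
    sigmaMap_prodForm, prodMap_mem_prodMapSubalgebra_iff]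

/-- The restriction `a|V₁ = ι₁^*a` of a `2`-form on `V₁ ⊕ V₂` to the first factor (`ι₁ = (·, 0)`). [cite: HulekLaface2019PicardNumbers, Prop. 2.2 / Cor. 2.3] [cite: Lange2023AbelianVarietiesComplex, §2.4.4 Cor. 2.4.24] -/
def restrictFst (a : (E₁ × E₂) [⋀^Fin 2]→L[ℝ] ℝ) : E₁ [⋀^Fin 2]→L[ℝ] ℝ :=
  a.compContinuousLinearMap (ContinuousLinearMap.inl ℝ E₁ E₂)

/-- The restriction `a|V₂ = ι₂^*a` of a `2`-form on `V₁ ⊕ V₂` to the second factor (`ι₂ = (0, ·)`). [cite: HulekLaface2019PicardNumbers, Prop. 2.2 / Cor. 2.3] [cite: Lange2023AbelianVarietiesComplex, §2.4.4 Cor. 2.4.24] -/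
def restrictSnd (a : (E₁ × E₂) [⋀^Fin 2]→L[ℝ] ℝ) : E₂ [⋀^Fin 2]→L[ℝ] ℝ :=
  a.compContinuousLinearMap (ContinuousLinearMap.inr ℝ E₁ E₂)

omit [FiniteDimensional ℂ E₁] [FiniteDimensional ℂ E₂] in
/-- `a|V₁(x, y) = a((x, 0), (y, 0))`. [cite: Lange2023AbelianVarietiesComplex, §2.4.4 Cor. 2.4.24] -/
@[simp]
theorem restrictFst_apply (a : (E₁ × E₂) [⋀^Fin 2]→L[ℝ] ℝ) (x y : E₁) : restrictFst a ![x, y] = a ![(x, 0), (y, 0)] := by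
  rw [restrictFst, ContinuousAlternatingMap.compContinuousLinearMap_apply]
  congr 1
  funext i
  fin_cases i <;> rfl

omit [FiniteDimensional ℂ E₁] [FiniteDimensional ℂ E₂] in
/-- `a|V₂(x, y) = a((0, x), (0, y))`. [cite: Lange2023AbelianVarietiesComplex, §2.4.4 Cor. 2.4.24] -/
@[simp]
theorem restrictSnd_apply (a : (E₁ × E₂) [⋀^Fin 2]→L[ℝ] ℝ) (x y : E₂) : restrictSnd a ![x, y] = a ![(0, x), (0, y)] := by
  rw [restrictSnd, ContinuousAlternatingMap.compContinuousLinearMap_apply]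
  congr 1
  funext i
  fin_cases i <;> rfl

omit [FiniteDimensional ℂ E₁] [FiniteDimensional ℂ E₂] in
/-- `(a₁ ⊞ a₂)|V₁ = a₁`. [cite: Lange2023AbelianVarietiesComplex, §2.4.4 Cor. 2.4.24] -/
theorem restrictFst_prodForm (a₁ : E₁ [⋀^Fin 2]→L[ℝ] ℝ) (a₂ : E₂ [⋀^Fin 2]→L[ℝ] ℝ) : restrictFst (prodForm a₁ a₂) = a₁ :=
  twoForm_ext₂ fun x y ↦ by rw [restrictFst_apply, prodForm_apply, twoForm_self, add_zero]

omit [FiniteDimensional ℂ E₁] [FiniteDimensional ℂ E₂] in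
/-- `(a₁ ⊞ a₂)|V₂ = a₂`. [cite: Lange2023AbelianVarietiesComplex, §2.4.4 Cor. 2.4.24] -/
theorem restrictSnd_prodForm (a₁ : E₁ [⋀^Fin 2]→L[ℝ] ℝ) (a₂ : E₂ [⋀^Fin 2]→L[ℝ] ℝ) : restrictSnd (prodForm a₁ a₂) = a₂ :=
  twoForm_ext₂ fun x y ↦ by rw [restrictSnd_apply, prodForm_apply, twoForm_self, zero_add]

omit [FiniteDimensional ℂ E₁] [FiniteDimensional ℂ E₂] in
/-- **A `2`-form on `V₁ ⊕ V₂` vanishing on `V₁ × V₂` is the product form of its restrictions**: `a = a|V₁ ⊞ a|V₂`. [cite: HulekLaface2019PicardNumbers, Prop. 2.2 / Cor. 2.3] [cite: Lange2023AbelianVarietiesComplex, §2.4.4 Cor. 2.4.24] -/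
theorem prodForm_restrictFst_restrictSnd {a : (E₁ × E₂) [⋀^Fin 2]→L[ℝ] ℝ} (ha : ∀ (x : E₁) (y : E₂), a ![(x, 0), (0, y)] = 0) :
    prodForm (restrictFst a) (restrictSnd a) = a := by
  refine twoForm_ext₂ fun u v ↦ ?_
  rw [prodForm_apply, restrictFst_apply, restrictSnd_apply]
  have hu : u = ((u.1, (0 : E₂)) : E₁ × E₂) + ((0 : E₁), u.2) := by rw [Prod.mk_add_mk, add_zero, zero_add]
  have hv : v = ((v.1, (0 : E₂)) : E₁ × E₂) + ((0 : E₁), v.2) := by rw [Prod.mk_add_mk, add_zero, zero_add]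
  conv_rhs => rw [hu, hv, twoForm_add_left, twoForm_add_right, twoForm_add_right, ha, twoForm_swap a (0, u.2), ha]
  rw [add_zero, neg_zero, zero_add]

/-- `P₀` is injective when `κ♭ ∘ P₀ = 1`. [cite: LooijengaLunts1997, §3 (3.5)] -/
private theorem rinv_injective {E : Type*} [NormedAddCommGroup E] [NormedSpace ℂ E] [FiniteDimensional ℂ E]
    {κ : E [⋀^Fin 2]→L[ℝ] ℝ} {P₀ : (E →L[ℝ] ℝ) →ₗ[ℝ] E} (h₁ : flat κ ∘ₗ P₀ = 1) : Injective P₀ := fun ξ ζ hξ ↦ by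
  rw [← flat_apply_rinv h₁ ξ, ← flat_apply_rinv h₁ ζ, hξ]

variable {κ₁ : E₁ [⋀^Fin 2]→L[ℝ] ℝ} {κ₂ : E₂ [⋀^Fin 2]→L[ℝ] ℝ} (h₁ : flat κ₁ ∘ₗ P₁ = 1) (h₂ : flat κ₂ ∘ₗ P₂ = 1)

include h₂ in
/-- **A form of `𝔞(𝒜₁ × 𝒜₂)` vanishes on `V₁ × V₂`** (`σ_a` is block diagonal, `P₂` is injective): `a((x, 0), (0, y)) = 0`. [cite: HulekLaface2019PicardNumbers, Prop. 2.2 / Cor. 2.3] [cite: LooijengaLunts1997, §3 (3.5)] -/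
theorem apply_inl_inr_eq_zero_of_mem_formsOf {a : (E₁ × E₂) [⋀^Fin 2]→L[ℝ] ℝ}
    (ha : a ∈ formsOf (dualProdMap E₁ E₂ P₁ P₂) (prodMapSubalgebra 𝒜₁ 𝒜₂)) (x : E₁) (y : E₂) : a ![(x, 0), (0, y)] = 0 := by
  obtain ⟨b₁, -, b₂, -, hb⟩ := mem_prodMapSubalgebra_iff.1 (mem_formsOf_iff.1 ha)
  have key := congrArg (fun f ↦ (f (x, 0)).2) hb
  simp only [LinearMap.comp_apply, dualProdMap_apply, LinearMap.prodMap_apply, map_zero] at key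
  have key' : (flat a (x, 0)).comp (ContinuousLinearMap.inr ℝ E₁ E₂) = 0 := by
    apply rinv_injective h₂
    rw [key, map_zero]
  have := congrArg (fun f : E₂ →L[ℝ] ℝ ↦ f y) key'
  simpa [flat_apply] using this

include h₂ in
/-- **Every form of `𝔞(𝒜₁ × 𝒜₂)` is a product form**: `a = a|V₁ ⊞ a|V₂`. [cite: HulekLaface2019PicardNumbers, Prop. 2.2 / Cor. 2.3] [cite: LooijengaLunts1997, §3 (3.5)] -/
theorem eq_prodForm_of_mem_formsOf {a : (E₁ × E₂) [⋀^Fin 2]→L[ℝ] ℝ}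
    (ha : a ∈ formsOf (dualProdMap E₁ E₂ P₁ P₂) (prodMapSubalgebra 𝒜₁ 𝒜₂)) : a = prodForm (restrictFst a) (restrictSnd a) :=
  (prodForm_restrictFst_restrictSnd (apply_inl_inr_eq_zero_of_mem_formsOf h₂ ha)).symm

include h₂ in
/-- **`𝔞(𝒜₁ × 𝒜₂) = p₁^*𝔞(𝒜₁) ⊕ p₂^*𝔞(𝒜₂)`**: `a ∈ 𝔞(𝒜₁ × 𝒜₂) ⟺ a = a₁ ⊞ a₂` with `aᵢ ∈ 𝔞(𝒜ᵢ)` ("the (exterior) pullback of line bundles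
yields an isomorphism `∏ Pic(A_i^{n_i}) ≅ Pic(∏ A_i^{n_i})`", at the level of `𝔞(𝒜)`). [cite: HulekLaface2019PicardNumbers, Prop. 2.2 / Cor. 2.3] [cite: LooijengaLunts1997, §3 (p. 14, standard reduction: 𝔤_NS(X) = 𝔤_NS(X₁^m₁) × ⋯ × 𝔤_NS(X_k^m_k))] -/
theorem mem_formsOf_prod_iff {a : (E₁ × E₂) [⋀^Fin 2]→L[ℝ] ℝ} :
    a ∈ formsOf (dualProdMap E₁ E₂ P₁ P₂) (prodMapSubalgebra 𝒜₁ 𝒜₂) ↔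
      ∃ a₁ ∈ formsOf P₁ 𝒜₁, ∃ a₂ ∈ formsOf P₂ 𝒜₂, a = prodForm a₁ a₂ := by
  constructor
  · intro ha
    have e := eq_prodForm_of_mem_formsOf h₂ ha
    rw [e, prodForm_mem_formsOf_iff] at ha
    exact ⟨_, ha.1, _, ha.2, e⟩
  · rintro ⟨a₁, ha₁, a₂, ha₂, rfl⟩
    exact prodForm_mem_formsOf_iff.2 ⟨ha₁, ha₂⟩

include h₂ in
/-- The restrictions of a form of `𝔞(𝒜₁ × 𝒜₂)` lie in `𝔞(𝒜₁)`, `𝔞(𝒜₂)`. [cite: HulekLaface2019PicardNumbers, Prop. 2.2 / Cor. 2.3] [cite: LooijengaLunts1997, §3 (3.5)] -/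
theorem restrictFst_mem_formsOf {a : (E₁ × E₂) [⋀^Fin 2]→L[ℝ] ℝ}
    (ha : a ∈ formsOf (dualProdMap E₁ E₂ P₁ P₂) (prodMapSubalgebra 𝒜₁ 𝒜₂)) :
    restrictFst a ∈ formsOf P₁ 𝒜₁ ∧ restrictSnd a ∈ formsOf P₂ 𝒜₂ := by
  have e := eq_prodForm_of_mem_formsOf h₂ ha
  rw [e, prodForm_mem_formsOf_iff] at ha
  exact ha

end FormsProd

/-! ### §5 THE ABELIAN VARIETY `X₁ × X₂` with `Hom(X₁, X₂) = 0 = Hom(X₂, X₁)` -/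

section Torus

variable {ι₁ ι₂ : Type*} [Fintype ι₁] [Fintype ι₂] [DecidableEq ι₁] [DecidableEq ι₂] {E₁ E₂ : Type*}
  [NormedAddCommGroup E₁] [NormedSpace ℂ E₁] [NormedAddCommGroup E₂] [NormedSpace ℂ E₂]
  (Φ₁ : (ι₁ → ℝ) ≃L[ℝ] E₁) (Φ₂ : (ι₂ → ℝ) ≃L[ℝ] E₂)

/-- **`ρ(A 0; 0 D) = ρ₁(A) × ρ₂(D)`**: on `X₁ × X₂` a block-diagonal rational matrix (concatenated lattice bases) acts on
`V₁ ⊕ V₂` by the block-diagonal operator ("`End_ℚ(X₁) × End_ℚ(X₂) ↪ End_ℚ(X₁ × X₂)`, `(A, D) ↦ (A 0; 0 D)`"). [cite: Lange2023AbelianVarietiesComplex, §2.4.4 Cor. 2.4.26 (proof)] -/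
theorem rhoR_prodPeriod_fromBlocks (A : Matrix ι₁ ι₁ ℚ) (D : Matrix ι₂ ι₂ ℚ) :
    rhoR (prodPeriod Φ₁ Φ₂) (Matrix.fromBlocks A 0 0 D) = (rhoR Φ₁ A).prodMap (rhoR Φ₂ D) := by
  refine LinearMap.ext fun v ↦ ?_
  obtain ⟨w, rfl⟩ := (prodPeriod Φ₁ Φ₂).surjective v
  rw [rhoR_apply_apply, Matrix.fromBlocks_map, Matrix.fromBlocks_mulVec, Matrix.map_zero _ Rat.cast_zero,
    Matrix.map_zero _ Rat.cast_zero, Matrix.zero_mulVec, Matrix.zero_mulVec, add_zero, zero_add, prodPeriod_apply,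
    prodPeriod_apply, LinearMap.prodMap_apply, rhoR_apply_apply, rhoR_apply_apply]
  rfl

/-- **`End(X₁) ⊗ ℝ × End(X₂) ⊗ ℝ ⊆ End(X₁ × X₂) ⊗ ℝ`** (every torus: `ρ₁(A) × ρ₂(D) = ρ(A 0; 0 D)`). [cite: Lange2023AbelianVarietiesComplex, §2.4.4 Cor. 2.4.26 (proof)] -/
theorem prodMapSubalgebra_endAlgReal_le :
    prodMapSubalgebra (endAlgReal Φ₁) (endAlgReal Φ₂) ≤ endAlgReal (prodPeriod Φ₁ Φ₂) := by
  intro a ha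
  obtain ⟨a₁, ha₁, a₂, ha₂, rfl⟩ := mem_prodMapSubalgebra_iff.1 ha
  rw [show a₁.prodMap a₂ = prodMapₗ E₁ E₂ (LinearMap.inl ℝ _ _ a₁) + prodMapₗ E₁ E₂ (LinearMap.inr ℝ _ _ a₂) by
    rw [← map_add, LinearMap.inl_apply, LinearMap.inr_apply, Prod.mk_add_mk, add_zero, zero_add, prodMapₗ_apply]]
  rw [mem_endAlgReal_iff] at ha₁ ha₂
  have key₁ : Submodule.span ℝ (rhoR Φ₁ '' (endAlgRat Φ₁ : Set (Matrix ι₁ ι₁ ℚ))) ≤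
      (Subalgebra.toSubmodule (endAlgReal (prodPeriod Φ₁ Φ₂))).comap (prodMapₗ E₁ E₂ ∘ₗ LinearMap.inl ℝ _ _) := by
    refine Submodule.span_le.2 ?_
    rintro _ ⟨A, hA, rfl⟩
    rw [SetLike.mem_coe, Submodule.mem_comap, LinearMap.comp_apply, LinearMap.inl_apply, prodMapₗ_apply,
      Subalgebra.mem_toSubmodule, show (rhoR Φ₁ A).prodMap (0 : Module.End ℝ E₂) =
        rhoR (prodPeriod Φ₁ Φ₂) (Matrix.fromBlocks A 0 0 0) by rw [rhoR_prodPeriod_fromBlocks, map_zero]]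
    exact rhoR_mem_endAlgReal _ ((fromBlocks_mem_endAlgRat_prod_iff Φ₁ Φ₂).2
      ⟨hA, Submodule.zero_mem _, Submodule.zero_mem _, Subalgebra.zero_mem _⟩)
  have key₂ : Submodule.span ℝ (rhoR Φ₂ '' (endAlgRat Φ₂ : Set (Matrix ι₂ ι₂ ℚ))) ≤
      (Subalgebra.toSubmodule (endAlgReal (prodPeriod Φ₁ Φ₂))).comap (prodMapₗ E₁ E₂ ∘ₗ LinearMap.inr ℝ _ _) := by
    refine Submodule.span_le.2 ?_
    rintro _ ⟨D, hD, rfl⟩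
    rw [SetLike.mem_coe, Submodule.mem_comap, LinearMap.comp_apply, LinearMap.inr_apply, prodMapₗ_apply,
      Subalgebra.mem_toSubmodule, show (0 : Module.End ℝ E₁).prodMap (rhoR Φ₂ D) =
        rhoR (prodPeriod Φ₁ Φ₂) (Matrix.fromBlocks 0 0 0 D) by rw [rhoR_prodPeriod_fromBlocks, map_zero]]
    exact rhoR_mem_endAlgReal _ ((fromBlocks_mem_endAlgRat_prod_iff Φ₁ Φ₂).2
      ⟨Subalgebra.zero_mem _, Submodule.zero_mem _, Submodule.zero_mem _, hD⟩)
  exact (endAlgReal (prodPeriod Φ₁ Φ₂)).add_mem (key₁ ha₁) (key₂ ha₂)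

/-- **`End(X₁ × X₂) ⊗ ℝ = End(X₁) ⊗ ℝ × End(X₂) ⊗ ℝ` block-diagonally when `Hom_ℚ(X₁, X₂) = 0 = Hom_ℚ(X₂, X₁)`** ("Since
`Hom(X_ν, X_μ) = 0` … `End_ℚ(X) = ⊕_ν End_ℚ(X_ν^{n_ν})`", tensored with `ℝ`: the off-diagonal blocks of `mem_endAlgRat_prod_iff` vanish).
[cite: Lange2023AbelianVarietiesComplex, §2.4.4 Cor. 2.4.26 (proof)] [cite: LooijengaLunts1997, §3 (p. 14, standard reduction: 𝔤_NS(X) = 𝔤_NS(X₁^m₁) × ⋯ × 𝔤_NS(X_k^m_k))] -/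
theorem endAlgReal_prodPeriod_eq (h₁₂ : homRat Φ₁ Φ₂ = ⊥) (h₂₁ : homRat Φ₂ Φ₁ = ⊥) :
    endAlgReal (prodPeriod Φ₁ Φ₂) = prodMapSubalgebra (endAlgReal Φ₁) (endAlgReal Φ₂) := by
  refine le_antisymm (fun a ha ↦ ?_) (prodMapSubalgebra_endAlgReal_le Φ₁ Φ₂)
  rw [mem_endAlgReal_iff] at ha
  have key : Submodule.span ℝ (rhoR (prodPeriod Φ₁ Φ₂) '' (endAlgRat (prodPeriod Φ₁ Φ₂) : Set (Matrix (ι₁ ⊕ ι₂) (ι₁ ⊕ ι₂) ℚ)))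
      ≤ Subalgebra.toSubmodule (prodMapSubalgebra (endAlgReal Φ₁) (endAlgReal Φ₂)) := by
    refine Submodule.span_le.2 ?_
    rintro _ ⟨M, hM, rfl⟩
    obtain ⟨hA, hB, hC, hD⟩ := (mem_endAlgRat_prod_iff Φ₁ Φ₂ M).1 hM
    rw [h₂₁, Submodule.mem_bot] at hB
    rw [h₁₂, Submodule.mem_bot] at hC
    rw [SetLike.mem_coe, Subalgebra.mem_toSubmodule, ← Matrix.fromBlocks_toBlocks M, hB, hC, rhoR_prodPeriod_fromBlocks]
    exact prodMap_mem_prodMapSubalgebra (rhoR_mem_endAlgReal _ hA) (rhoR_mem_endAlgReal _ hD)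
  exact key ha

omit [Fintype ι₁] [Fintype ι₂] [DecidableEq ι₁] [DecidableEq ι₂] in
/-- `ω(x, 0) = 0` (plumbing). [folklore] -/
private theorem twoForm_zero_right' {F : Type*} [NormedAddCommGroup F] [NormedSpace ℂ F] (ω : F [⋀^Fin 2]→L[ℝ] ℝ)
    (x : F) : ω ![x, 0] = 0 := by
  rw [← zero_smul ℝ (0 : F), twoForm_smul_right, zero_mul]

omit [Fintype ι₁] [Fintype ι₂] [DecidableEq ι₁] [DecidableEq ι₂] in
/-- `ω(0, y) = 0` (plumbing). [folklore] -/
private theorem twoForm_zero_left' {F : Type*} [NormedAddCommGroup F] [NormedSpace ℂ F] (ω : F [⋀^Fin 2]→L[ℝ] ℝ)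
    (y : F) : ω ![0, y] = 0 := by
  rw [← zero_smul ℝ (0 : F), twoForm_smul_left, zero_mul]

variable {Φ₁ Φ₂} {η₁ : E₁ [⋀^Fin 2]→L[ℝ] ℝ} {η₂ : E₂ [⋀^Fin 2]→L[ℝ] ℝ} {G₁ : Matrix ι₁ ι₁ ℚ} {G₂ : Matrix ι₂ ι₂ ℚ}

/-- The rational Gram matrix of the product polarisation `η₁ ⊞ η₂` is `(G₁ 0; 0 G₂)` (`latticeGram_prod` over `ℚ`). [cite: Lange2023AbelianVarietiesComplex, §2.4.4 Cor. 2.4.24] -/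
private theorem fromBlocks_ratCast_eq_latticeGram_prod (hG₁ : G₁.map ((↑) : ℚ → ℝ) = latticeGram Φ₁ η₁)
    (hG₂ : G₂.map ((↑) : ℚ → ℝ) = latticeGram Φ₂ η₂) :
    (Matrix.fromBlocks G₁ 0 0 G₂).map ((↑) : ℚ → ℝ) = latticeGram (prodPeriod Φ₁ Φ₂) (prodForm η₁ η₂) := by
  rw [Matrix.fromBlocks_map, hG₁, hG₂, Matrix.map_zero _ Rat.cast_zero, Matrix.map_zero _ Rat.cast_zero, latticeGram_prod]

variable [FiniteDimensional ℂ E₁] [FiniteDimensional ℂ E₂] {P₁ : (E₁ →L[ℝ] ℝ) →ₗ[ℝ] E₁} {P₂ : (E₂ →L[ℝ] ℝ) →ₗ[ℝ] E₂}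
  (hη₁ : IsRiemannForm Φ₁ η₁) (hη₂ : IsRiemannForm Φ₂ η₂) (hG₁ : G₁.map ((↑) : ℚ → ℝ) = latticeGram Φ₁ η₁)
  (hG₂ : G₂.map ((↑) : ℚ → ℝ) = latticeGram Φ₂ η₂) (h₁ : flat η₁ ∘ₗ P₁ = 1) (h₂ : flat η₂ ∘ₗ P₂ = 1)
  (h₁₂ : homRat Φ₁ Φ₂ = ⊥) (h₂₁ : homRat Φ₂ Φ₁ = ⊥)

include hη₁ hη₂ hG₁ hG₂ h₁ h₂ h₁₂ h₂₁ in
/-- **"The Néron–Severi group of `X` is just the direct sum of the Néron–Severi groups of its isotypical factors"**, over `ℝ`, for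
`Hom`-orthogonal polarised `X₁`, `X₂`: `NS(X₁ × X₂) ⊗ ℝ = {p₁^*a₁ + p₂^*a₂ : aᵢ ∈ NS(Xᵢ) ⊗ ℝ}` (`𝔞(End(X) ⊗ ℝ) = NS(X) ⊗ ℝ` on the three
tori, `formsOf_endAlgReal_eq`, and `mem_formsOf_prod_iff`). [cite: LooijengaLunts1997, §3 (p. 14, standard reduction: 𝔤_NS(X) = 𝔤_NS(X₁^m₁) × ⋯ × 𝔤_NS(X_k^m_k))] [cite: HulekLaface2019PicardNumbers, Prop. 2.2 / Cor. 2.3] -/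
theorem mem_neronSeveriR_prodPeriod_iff {a : (E₁ × E₂) [⋀^Fin 2]→L[ℝ] ℝ} :
    a ∈ neronSeveriR (prodPeriod Φ₁ Φ₂) ↔ ∃ a₁ ∈ neronSeveriR Φ₁, ∃ a₂ ∈ neronSeveriR Φ₂, a = prodForm a₁ a₂ := by
  rw [← formsOf_endAlgReal_eq (prodPeriod Φ₁ Φ₂) (hη₁.prod hη₂) (fromBlocks_ratCast_eq_latticeGram_prod hG₁ hG₂)
      (flat_prodForm_comp_dualProdMap h₁ h₂), endAlgReal_prodPeriod_eq Φ₁ Φ₂ h₁₂ h₂₁, mem_formsOf_prod_iff h₂,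
    formsOf_endAlgReal_eq Φ₁ hη₁ hG₁ h₁, formsOf_endAlgReal_eq Φ₂ hη₂ hG₂ h₂]

include hη₁ hη₂ hG₁ hG₂ h₁ h₂ h₁₂ h₂₁ in
/-- `p₁^*a₁ + p₂^*a₂ ∈ NS(X₁ × X₂) ⊗ ℝ ⟺ a₁ ∈ NS(X₁) ⊗ ℝ ∧ a₂ ∈ NS(X₂) ⊗ ℝ` (`Hom`-orthogonal polarised tori). [cite: LooijengaLunts1997, §3 (p. 14, standard reduction: 𝔤_NS(X) = 𝔤_NS(X₁^m₁) × ⋯ × 𝔤_NS(X_k^m_k))] [cite: HulekLaface2019PicardNumbers, Prop. 2.2 / Cor. 2.3] -/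
theorem prodForm_mem_neronSeveriR_prodPeriod_iff {a₁ : E₁ [⋀^Fin 2]→L[ℝ] ℝ} {a₂ : E₂ [⋀^Fin 2]→L[ℝ] ℝ} :
    prodForm a₁ a₂ ∈ neronSeveriR (prodPeriod Φ₁ Φ₂) ↔ a₁ ∈ neronSeveriR Φ₁ ∧ a₂ ∈ neronSeveriR Φ₂ := by
  rw [← formsOf_endAlgReal_eq (prodPeriod Φ₁ Φ₂) (hη₁.prod hη₂) (fromBlocks_ratCast_eq_latticeGram_prod hG₁ hG₂)
      (flat_prodForm_comp_dualProdMap h₁ h₂), endAlgReal_prodPeriod_eq Φ₁ Φ₂ h₁₂ h₂₁, prodForm_mem_formsOf_iff,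
    formsOf_endAlgReal_eq Φ₁ hη₁ hG₁ h₁, formsOf_endAlgReal_eq Φ₂ hη₂ hG₂ h₂]

variable [Nontrivial E₁] [Nontrivial E₂]

include hη₁ hη₂ hG₁ hG₂ h₁₂ h₂₁ in
/-- **The structure theorem for `𝔤_NS(X₁ × X₂; ℝ)` in block form**: `𝔤_NS(X₁ × X₂; ℝ) = ρ(model(η₁ ⊞ η₂, P₁ ⊕ P₂, End(X₁)⊗ℝ × End(X₂)⊗ℝ))`
(row A1-54's `neronSeveriLieAlgebra_eq_llModel` for the product torus polarised by `η₁ ⊞ η₂`, with `endAlgReal_prodPeriod_eq`). [cite: LooijengaLunts1997, §3 (3.6)] [cite: LooijengaLunts1997, §3 (p. 14, standard reduction: 𝔤_NS(X) = 𝔤_NS(X₁^m₁) × ⋯ × 𝔤_NS(X_k^m_k))] -/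
theorem neronSeveriLieAlgebra_prodPeriod_eq_llModel :
    neronSeveriLieAlgebra (prodPeriod Φ₁ Φ₂) =
      llModel (flat_prodForm_comp_dualProdMap h₁ h₂)
        (prodMapSubalgebra_adj (hη₁.endAlgReal_adj Φ₁ hG₁ h₁) (hη₂.endAlgReal_adj Φ₂ hG₂ h₂)) := by
  refine LieSubalgebra.toSubmodule_injective ?_
  rw [neronSeveriLieAlgebra_eq_llModel (prodPeriod Φ₁ Φ₂) (hη₁.prod hη₂) (fromBlocks_ratCast_eq_latticeGram_prod hG₁ hG₂)
      (flat_prodForm_comp_dualProdMap h₁ h₂), llModel_toSubmodule, llModel_toSubmodule, endAlgReal_prodPeriod_eq Φ₁ Φ₂ h₁₂ h₂₁]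

include hη₁ hη₂ hG₁ hG₂ h₁ h₂ h₁₂ h₂₁ in
/-- `𝔤_NS(X₁ × X₂; ℝ) = ρ(sumDualBlockDiag(model₁ × model₂))` as a subspace of `𝔤𝔩(H•(X₁ × X₂; ℂ))`. [cite: LooijengaLunts1997, §3 (p. 14, standard reduction: 𝔤_NS(X) = 𝔤_NS(X₁^m₁) × ⋯ × 𝔤_NS(X_k^m_k))] -/
theorem neronSeveriLieAlgebra_prodPeriod_toSubmodule :
    (neronSeveriLieAlgebra (prodPeriod Φ₁ Φ₂)).toSubmodule =
      ((model η₁ P₁ (endAlgReal Φ₁)).prod (model η₂ P₂ (endAlgReal Φ₂))).map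
        (spinorRepLin (E₁ × E₂) ∘ₗ (sumDualBlockDiag E₁ E₂).toLinearMap) := by
  rw [neronSeveriLieAlgebra_prodPeriod_eq_llModel hη₁ hη₂ hG₁ hG₂ h₁ h₂ h₁₂ h₂₁, llModel_toSubmodule, model_prod_eq,
    Submodule.map_comp]

/-- **Looijenga–Lunts' standard reduction, product step: `𝔤_NS(X₁ × X₂; ℝ) ≃ₗ⁅ℝ⁆ 𝔤_NS(X₁; ℝ) × 𝔤_NS(X₂; ℝ)`** for polarised complex tori
(abelian varieties) `X₁`, `X₂` of positive dimension with `Hom_ℚ(X₁, X₂) = 0 = Hom_ℚ(X₂, X₁)` ("Since the Néron–Severi group of `X` is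
just the direct sum of the Néron–Severi groups of its isotypical factors, the same is true for the Néron–Severi Lie algebra:
`𝔤_NS(X) = 𝔤_NS(X₁^{m₁}) × ⋯ × 𝔤_NS(X_k^{m_k})`", binary form).  The isomorphism is `ρ(sumDualBlockDiag(x₁, x₂)) ↦ (ρ₁ x₁, ρ₂ x₂)`
(`_apply_of_eq`): `h ↦ (h, h)`, `e_{p₁^*a₁+p₂^*a₂} ↦ (e_{a₁}, e_{a₂})`, `f_{p₁^*a₁+p₂^*a₂} ↦ (f_{a₁}, f_{a₂})`.  The data `ηᵢ, Gᵢ, Pᵢ`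
(Riemann forms, their rational Gram matrices, inverses of their flat maps) exist for every abelian variety
(`IsAbelianVariety.nonempty_neronSeveriLieAlgebra_prodPeriod_equiv`). [cite: LooijengaLunts1997, §3 (p. 14, standard reduction: 𝔤_NS(X) = 𝔤_NS(X₁^m₁) × ⋯ × 𝔤_NS(X_k^m_k))] [cite: LooijengaLunts1997, §1 (p. 4, exterior direct sum and tensor product)] -/
def neronSeveriLieAlgebraProdEquiv :
    neronSeveriLieAlgebra (prodPeriod Φ₁ Φ₂) ≃ₗ⁅ℝ⁆ (neronSeveriLieAlgebra Φ₁ × neronSeveriLieAlgebra Φ₂) :=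
  (LieEquiv.ofEq _ _ (congrArg SetLike.coe
      (neronSeveriLieAlgebra_prodPeriod_eq_llModel hη₁ hη₂ hG₁ hG₂ h₁ h₂ h₁₂ h₂₁))).trans
    ((llModelProdEquiv h₁ h₂ (hη₁.endAlgReal_adj Φ₁ hG₁ h₁) (hη₂.endAlgReal_adj Φ₂ hG₂ h₂)
        (flat_prodForm_comp_dualProdMap h₁ h₂)
        (prodMapSubalgebra_adj (hη₁.endAlgReal_adj Φ₁ hG₁ h₁) (hη₂.endAlgReal_adj Φ₂ hG₂ h₂))).trans
      (lieEquivProdCongr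
        (LieEquiv.ofEq _ _ (congrArg SetLike.coe (neronSeveriLieAlgebra_eq_llModel Φ₁ hη₁ hG₁ h₁).symm))
        (LieEquiv.ofEq _ _ (congrArg SetLike.coe (neronSeveriLieAlgebra_eq_llModel Φ₂ hη₂ hG₂ h₂).symm))))

/-- **`neronSeveriLieAlgebraProdEquiv (ρ(sumDualBlockDiag(x₁, x₂))) = (ρ₁ x₁, ρ₂ x₂)`** for `xᵢ ∈ model(ηᵢ, Pᵢ, End(Xᵢ) ⊗ ℝ)`. [cite: LooijengaLunts1997, §3 (p. 14, standard reduction: 𝔤_NS(X) = 𝔤_NS(X₁^m₁) × ⋯ × 𝔤_NS(X_k^m_k))] -/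
theorem neronSeveriLieAlgebraProdEquiv_apply_of_eq {T : neronSeveriLieAlgebra (prodPeriod Φ₁ Φ₂)}
    {x₁ : Module.End ℝ (sumDual E₁)} {x₂ : Module.End ℝ (sumDual E₂)} (hx₁ : x₁ ∈ model η₁ P₁ (endAlgReal Φ₁))
    (hx₂ : x₂ ∈ model η₂ P₂ (endAlgReal Φ₂))
    (hT : (T : Module.End ℂ (GForm (E₁ × E₂) ℂ)) = spinorRepLin (E₁ × E₂) (sumDualBlockDiag E₁ E₂ (x₁, x₂))) :
    ((neronSeveriLieAlgebraProdEquiv hη₁ hη₂ hG₁ hG₂ h₁ h₂ h₁₂ h₂₁ T).1 : Module.End ℂ (GForm E₁ ℂ)) =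
        spinorRepLin E₁ x₁ ∧
      ((neronSeveriLieAlgebraProdEquiv hη₁ hη₂ hG₁ hG₂ h₁ h₂ h₁₂ h₂₁ T).2 : Module.End ℂ (GForm E₂ ℂ)) =
        spinorRepLin E₂ x₂ := by
  have key := llModelProdEquiv_apply_of_eq h₁ h₂ (hη₁.endAlgReal_adj Φ₁ hG₁ h₁) (hη₂.endAlgReal_adj Φ₂ hG₂ h₂)
    (flat_prodForm_comp_dualProdMap h₁ h₂)
    (prodMapSubalgebra_adj (hη₁.endAlgReal_adj Φ₁ hG₁ h₁) (hη₂.endAlgReal_adj Φ₂ hG₂ h₂))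
    (T := LieEquiv.ofEq _ _ (congrArg SetLike.coe
      (neronSeveriLieAlgebra_prodPeriod_eq_llModel hη₁ hη₂ hG₁ hG₂ h₁ h₂ h₁₂ h₂₁)) T) hx₁ hx₂ hT
  exact key


/-! #### Values: `h ↦ (h, h)`, `e_{p₁^*a₁ + p₂^*a₂} ↦ (e_{a₁}, e_{a₂})`, `f ↦ (f, f)`; dimension -/

omit [Nontrivial E₁] in
include hη₁ hG₁ h₁ in
/-- `ψ₂(a) ∈ model(η₀, P₀, End(X) ⊗ ℝ)` for `a ∈ NS(X) ⊗ ℝ` (`ψ₂(a) = ψ₂(η₀(σ_a·,·))`, `σ_a ∈ (End(X) ⊗ ℝ)^+`). [cite: LooijengaLunts1997, §3 (3.6)] -/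
theorem upEnd_mem_model_endAlgReal {a₁ : E₁ [⋀^Fin 2]→L[ℝ] ℝ} (ha₁ : a₁ ∈ neronSeveriR Φ₁) :
    upEnd a₁ ∈ model η₁ P₁ (endAlgReal Φ₁) := by
  rw [← formsOf_endAlgReal_eq Φ₁ hη₁ hG₁ h₁] at ha₁
  rw [upEnd_eq_upMap_sigmaMap h₁ a₁]
  exact upMap_mem_model (sigmaMap_mem_symmPart h₁ ha₁)

omit [Nontrivial E₁] [Nontrivial E₂] in
include hη₁ hη₂ hG₁ hG₂ h₁ h₂ h₁₂ h₂₁ in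
/-- `e_{p₁^*a₁ + p₂^*a₂} ∈ 𝔤_NS(X₁ × X₂; ℝ)` for `aᵢ ∈ NS(Xᵢ) ⊗ ℝ`. [cite: LooijengaLunts1997, §1 (1.1)] [cite: LooijengaLunts1997, §3 (p. 14, standard reduction: 𝔤_NS(X) = 𝔤_NS(X₁^m₁) × ⋯ × 𝔤_NS(X_k^m_k))] -/
theorem lefschetzG_prodForm_mem_neronSeveriLieAlgebra {a₁ : E₁ [⋀^Fin 2]→L[ℝ] ℝ} {a₂ : E₂ [⋀^Fin 2]→L[ℝ] ℝ}
    (ha₁ : a₁ ∈ neronSeveriR Φ₁) (ha₂ : a₂ ∈ neronSeveriR Φ₂) :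
    lefschetzG (prodForm a₁ a₂) ∈ neronSeveriLieAlgebra (prodPeriod Φ₁ Φ₂) :=
  lefschetzG_mem_neronSeveriLieAlgebra _
    ((prodForm_mem_neronSeveriR_prodPeriod_iff hη₁ hη₂ hG₁ hG₂ h₁ h₂ h₁₂ h₂₁).2 ⟨ha₁, ha₂⟩)

/-- **`e_{p₁^*a₁ + p₂^*a₂} ↦ (e_{a₁}, e_{a₂})`** ("`e_{(a′,a″)}(m′ ⊗ m″) = e_{a′}m′ ⊗ m″ + m′ ⊗ e_{a″}m″`": `ψ₂(a₁ ⊞ a₂) = (ψ₂(a₁), ψ₂(a₂))` and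
`ρψ₂ = e`). [cite: LooijengaLunts1997, §1 (p. 4, exterior direct sum and tensor product)] [cite: LooijengaLunts1997, §3 (p. 14, standard reduction: 𝔤_NS(X) = 𝔤_NS(X₁^m₁) × ⋯ × 𝔤_NS(X_k^m_k))] -/
theorem neronSeveriLieAlgebraProdEquiv_lefschetzG {a₁ : E₁ [⋀^Fin 2]→L[ℝ] ℝ} {a₂ : E₂ [⋀^Fin 2]→L[ℝ] ℝ}
    (ha₁ : a₁ ∈ neronSeveriR Φ₁) (ha₂ : a₂ ∈ neronSeveriR Φ₂) {T : neronSeveriLieAlgebra (prodPeriod Φ₁ Φ₂)}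
    (hT : (T : Module.End ℂ (GForm (E₁ × E₂) ℂ)) = lefschetzG (prodForm a₁ a₂)) :
    neronSeveriLieAlgebraProdEquiv hη₁ hη₂ hG₁ hG₂ h₁ h₂ h₁₂ h₂₁ T =
      (⟨lefschetzG a₁, lefschetzG_mem_neronSeveriLieAlgebra Φ₁ ha₁⟩,
        ⟨lefschetzG a₂, lefschetzG_mem_neronSeveriLieAlgebra Φ₂ ha₂⟩) := by
  have hT' : (T : Module.End ℂ (GForm (E₁ × E₂) ℂ)) = spinorRepLin (E₁ × E₂) (sumDualBlockDiag E₁ E₂ (upEnd a₁, upEnd a₂)) := by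
    rw [hT, sumDualBlockDiag_upEnd, spinorRepLin_upEnd]
  obtain ⟨e₁, e₂⟩ := neronSeveriLieAlgebraProdEquiv_apply_of_eq hη₁ hη₂ hG₁ hG₂ h₁ h₂ h₁₂ h₂₁
    (upEnd_mem_model_endAlgReal hη₁ hG₁ h₁ ha₁) (upEnd_mem_model_endAlgReal hη₂ hG₂ h₂ ha₂) hT'
  rw [spinorRepLin_upEnd] at e₁ e₂
  exact Prod.ext (Subtype.ext e₁) (Subtype.ext e₂)

/-- **`h ↦ (h, h)`** (the grading element `u = (u₁, u₂)` and `ρ(u) = h`): the isomorphism is graded. [cite: LooijengaLunts1997, §1 (p. 4, exterior direct sum and tensor product)] [cite: LooijengaLunts1997, §3 (p. 14, standard reduction: 𝔤_NS(X) = 𝔤_NS(X₁^m₁) × ⋯ × 𝔤_NS(X_k^m_k))] -/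
theorem neronSeveriLieAlgebraProdEquiv_countingG {T : neronSeveriLieAlgebra (prodPeriod Φ₁ Φ₂)}
    (hT : (T : Module.End ℂ (GForm (E₁ × E₂) ℂ)) = countingG (E₁ × E₂)) :
    neronSeveriLieAlgebraProdEquiv hη₁ hη₂ hG₁ hG₂ h₁ h₂ h₁₂ h₂₁ T =
      (⟨countingG E₁, countingG_mem_neronSeveriLieAlgebra Φ₁ hη₁ hG₁ h₁⟩,
        ⟨countingG E₂, countingG_mem_neronSeveriLieAlgebra Φ₂ hη₂ hG₂ h₂⟩) := by
  have hT' : (T : Module.End ℂ (GForm (E₁ × E₂) ℂ)) =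
      spinorRepLin (E₁ × E₂) (sumDualBlockDiag E₁ E₂ (gradingElement E₁, gradingElement E₂)) := by
    rw [hT, sumDualBlockDiag_gradingElement, spinorRepLin_gradingElement_eq_countingG]
  obtain ⟨e₁, e₂⟩ := neronSeveriLieAlgebraProdEquiv_apply_of_eq hη₁ hη₂ hG₁ hG₂ h₁ h₂ h₁₂ h₂₁
    (gradingElement_mem_model (one_mem_symmProdSpan h₁)) (gradingElement_mem_model (one_mem_symmProdSpan h₂)) hT'
  rw [spinorRepLin_gradingElement_eq_countingG] at e₁ e₂
  exact Prod.ext (Subtype.ext e₁) (Subtype.ext e₂)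

include hη₁ hη₂ hG₁ hG₂ h₁ h₂ in
/-- `h ∈ 𝔤_NS(X₁ × X₂; ℝ)`. [cite: LooijengaLunts1997, §1 (1.1)] -/
theorem countingG_prod_mem_neronSeveriLieAlgebra : countingG (E₁ × E₂) ∈ neronSeveriLieAlgebra (prodPeriod Φ₁ Φ₂) :=
  countingG_mem_neronSeveriLieAlgebra (prodPeriod Φ₁ Φ₂) (hη₁.prod hη₂)
    (fromBlocks_ratCast_eq_latticeGram_prod hG₁ hG₂) (flat_prodForm_comp_dualProdMap h₁ h₂)

/-- **Degrees are preserved**: `[h, x] ↦ ([h, x₁], [h, x₂])` — the `ad h`-gradings of `𝔤_NS(X₁ × X₂; ℝ)` and of the two factors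
correspond ("this decomposition is graded", (1.2)). [cite: LooijengaLunts1997, §1 (1.2)] [cite: LooijengaLunts1997, §3 (p. 14, standard reduction: 𝔤_NS(X) = 𝔤_NS(X₁^m₁) × ⋯ × 𝔤_NS(X_k^m_k))] -/
theorem neronSeveriLieAlgebraProdEquiv_lie_countingG (T : neronSeveriLieAlgebra (prodPeriod Φ₁ Φ₂)) :
    neronSeveriLieAlgebraProdEquiv hη₁ hη₂ hG₁ hG₂ h₁ h₂ h₁₂ h₂₁
        ⁅(⟨countingG (E₁ × E₂), countingG_prod_mem_neronSeveriLieAlgebra hη₁ hη₂ hG₁ hG₂ h₁ h₂⟩ :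
          neronSeveriLieAlgebra (prodPeriod Φ₁ Φ₂)), T⁆ =
      (⁅(⟨countingG E₁, countingG_mem_neronSeveriLieAlgebra Φ₁ hη₁ hG₁ h₁⟩ : neronSeveriLieAlgebra Φ₁),
          (neronSeveriLieAlgebraProdEquiv hη₁ hη₂ hG₁ hG₂ h₁ h₂ h₁₂ h₂₁ T).1⁆,
        ⁅(⟨countingG E₂, countingG_mem_neronSeveriLieAlgebra Φ₂ hη₂ hG₂ h₂⟩ : neronSeveriLieAlgebra Φ₂),
          (neronSeveriLieAlgebraProdEquiv hη₁ hη₂ hG₁ hG₂ h₁ h₂ h₁₂ h₂₁ T).2⁆) := by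
  rw [LieEquiv.map_lie, neronSeveriLieAlgebraProdEquiv_countingG hη₁ hη₂ hG₁ hG₂ h₁ h₂ h₁₂ h₂₁ rfl]
  rfl

omit [Fintype ι₁] [Fintype ι₂] [DecidableEq ι₁] [DecidableEq ι₂] [FiniteDimensional ℂ E₁] [FiniteDimensional ℂ E₂]
  [Nontrivial E₁] [Nontrivial E₂] in
/-- `p₁^*a₁ + p₂^*a₂` is non-degenerate (Lefschetz) when `a₁` and `a₂` are. [cite: LooijengaLunts1997, §1 (1.1)] [cite: Lange2023AbelianVarietiesComplex, §2.4.4 Cor. 2.4.24] -/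
theorem nondegenerate_prodForm_of_nondegenerate {a₁ : E₁ [⋀^Fin 2]→L[ℝ] ℝ} {a₂ : E₂ [⋀^Fin 2]→L[ℝ] ℝ}
    (h₁' : ∀ v : E₁, v ≠ 0 → ∃ w : E₁, a₁ ![v, w] ≠ 0) (h₂' : ∀ v : E₂, v ≠ 0 → ∃ w : E₂, a₂ ![v, w] ≠ 0) :
    ∀ v : E₁ × E₂, v ≠ 0 → ∃ w : E₁ × E₂, prodForm a₁ a₂ ![v, w] ≠ 0 := by
  intro v hv
  by_cases hv₁ : v.1 = 0
  · have hv₂ : v.2 ≠ 0 := fun h' ↦ hv (Prod.ext hv₁ h')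
    obtain ⟨w, hw⟩ := h₂' v.2 hv₂
    refine ⟨(0, w), ?_⟩
    rwa [prodForm_apply, hv₁, twoForm_zero_left', zero_add]
  · obtain ⟨w, hw⟩ := h₁' v.1 hv₁
    refine ⟨(w, 0), ?_⟩
    rwa [prodForm_apply, twoForm_zero_right', add_zero]

/-- **`f_{p₁^*a₁ + p₂^*a₂} ↦ (f_{a₁}, f_{a₂})`** for Lefschetz `aᵢ ∈ NS(Xᵢ) ⊗ ℝ`: the image of the `𝔰𝔩₂`-triple `(e, h, f)` of
`p₁^*a₁ + p₂^*a₂` is an `𝔰𝔩₂`-triple of the product with first two entries `(h, h)`, `(e_{a₁}, e_{a₂})`, so its components are the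
`𝔰𝔩₂`-partners `f_{aᵢ}` ("This `f` is then unique"). [cite: LooijengaLunts1997, §1 (1.1)] [cite: LooijengaLunts1997, §3 (p. 14, standard reduction: 𝔤_NS(X) = 𝔤_NS(X₁^m₁) × ⋯ × 𝔤_NS(X_k^m_k))] -/
theorem neronSeveriLieAlgebraProdEquiv_lefschetzDualG {a₁ : E₁ [⋀^Fin 2]→L[ℝ] ℝ} {a₂ : E₂ [⋀^Fin 2]→L[ℝ] ℝ}
    (ha₁ : a₁ ∈ neronSeveriR Φ₁) (ha₂ : a₂ ∈ neronSeveriR Φ₂) (h₁' : ∀ v : E₁, v ≠ 0 → ∃ w : E₁, a₁ ![v, w] ≠ 0)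
    (h₂' : ∀ v : E₂, v ≠ 0 → ∃ w : E₂, a₂ ![v, w] ≠ 0) {T : neronSeveriLieAlgebra (prodPeriod Φ₁ Φ₂)}
    (hT : (T : Module.End ℂ (GForm (E₁ × E₂) ℂ)) = lefschetzDualG (prodForm a₁ a₂)) :
    neronSeveriLieAlgebraProdEquiv hη₁ hη₂ hG₁ hG₂ h₁ h₂ h₁₂ h₂₁ T =
      (⟨lefschetzDualG a₁, lefschetzDualG_mem_neronSeveriLieAlgebra Φ₁ ha₁ h₁'⟩,
        ⟨lefschetzDualG a₂, lefschetzDualG_mem_neronSeveriLieAlgebra Φ₂ ha₂ h₂'⟩) := by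
  set Ψ := neronSeveriLieAlgebraProdEquiv hη₁ hη₂ hG₁ hG₂ h₁ h₂ h₁₂ h₂₁ with hΨ
  -- the `𝔰𝔩₂`-triple `(e, h, f)` inside `𝔤_NS(X₁ × X₂; ℝ)`
  set hX : neronSeveriLieAlgebra (prodPeriod Φ₁ Φ₂) :=
    ⟨countingG (E₁ × E₂), countingG_prod_mem_neronSeveriLieAlgebra hη₁ hη₂ hG₁ hG₂ h₁ h₂⟩ with hhX
  set eX : neronSeveriLieAlgebra (prodPeriod Φ₁ Φ₂) :=
    ⟨lefschetzG (prodForm a₁ a₂), lefschetzG_prodForm_mem_neronSeveriLieAlgebra hη₁ hη₂ hG₁ hG₂ h₁ h₂ h₁₂ h₂₁ ha₁ ha₂⟩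
    with heX
  have t : IsSl2Triple (countingG (E₁ × E₂)) (lefschetzG (prodForm a₁ a₂)) (T : Module.End ℂ (GForm (E₁ × E₂) ℂ)) := by
    rw [hT]; exact isSl2Triple_iff.2 ⟨nondegenerate_prodForm_of_nondegenerate h₁' h₂', rfl⟩
  have tX : IsSl2Triple hX eX T :=
    ⟨fun h0 ↦ t.h_ne_zero (congrArg Subtype.val h0), Subtype.ext t.lie_e_f, Subtype.ext t.lie_h_e_nsmul,
      Subtype.ext t.lie_h_f_nsmul⟩
  have tΨ := isSl2Triple_map_of_injective Ψ.toLieHom (fun x y hxy ↦ Ψ.injective hxy) tX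
  rw [LieEquiv.coe_toLieHom] at tΨ
  have eh : Ψ hX = (⟨countingG E₁, countingG_mem_neronSeveriLieAlgebra Φ₁ hη₁ hG₁ h₁⟩,
      ⟨countingG E₂, countingG_mem_neronSeveriLieAlgebra Φ₂ hη₂ hG₂ h₂⟩) :=
    neronSeveriLieAlgebraProdEquiv_countingG hη₁ hη₂ hG₁ hG₂ h₁ h₂ h₁₂ h₂₁ rfl
  have ee : Ψ eX = (⟨lefschetzG a₁, lefschetzG_mem_neronSeveriLieAlgebra Φ₁ ha₁⟩,
      ⟨lefschetzG a₂, lefschetzG_mem_neronSeveriLieAlgebra Φ₂ ha₂⟩) :=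
    neronSeveriLieAlgebraProdEquiv_lefschetzG hη₁ hη₂ hG₁ hG₂ h₁ h₂ h₁₂ h₂₁ ha₁ ha₂ rfl
  rw [eh, ee] at tΨ
  -- read the two components
  have t₁ : IsSl2Triple (countingG E₁) (lefschetzG a₁) (((Ψ T).1 : neronSeveriLieAlgebra Φ₁) : Module.End ℂ (GForm E₁ ℂ)) :=
    ⟨countingG_ne_zero, congrArg (fun z ↦ ((z.1 : neronSeveriLieAlgebra Φ₁) : Module.End ℂ (GForm E₁ ℂ))) tΨ.lie_e_f,
      congrArg (fun z ↦ ((z.1 : neronSeveriLieAlgebra Φ₁) : Module.End ℂ (GForm E₁ ℂ))) tΨ.lie_h_e_nsmul,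
      congrArg (fun z ↦ ((z.1 : neronSeveriLieAlgebra Φ₁) : Module.End ℂ (GForm E₁ ℂ))) tΨ.lie_h_f_nsmul⟩
  have t₂ : IsSl2Triple (countingG E₂) (lefschetzG a₂) (((Ψ T).2 : neronSeveriLieAlgebra Φ₂) : Module.End ℂ (GForm E₂ ℂ)) :=
    ⟨countingG_ne_zero, congrArg (fun z ↦ ((z.2 : neronSeveriLieAlgebra Φ₂) : Module.End ℂ (GForm E₂ ℂ))) tΨ.lie_e_f,
      congrArg (fun z ↦ ((z.2 : neronSeveriLieAlgebra Φ₂) : Module.End ℂ (GForm E₂ ℂ))) tΨ.lie_h_e_nsmul,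
      congrArg (fun z ↦ ((z.2 : neronSeveriLieAlgebra Φ₂) : Module.End ℂ (GForm E₂ ℂ))) tΨ.lie_h_f_nsmul⟩
  exact Prod.ext (Subtype.ext (eq_lefschetzDualG_of_isSl2Triple t₁)) (Subtype.ext (eq_lefschetzDualG_of_isSl2Triple t₂))

set_option synthInstance.maxHeartbeats 200000 in
set_option maxHeartbeats 800000 in
-- the additive / module instances on `↥(neronSeveriLieAlgebra (prodPeriod Φ₁ Φ₂))` are slow to find over `E₁ × E₂`
include hη₁ hη₂ hG₁ hG₂ h₁ h₂ h₁₂ h₂₁ in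
/-- **`dim_ℝ 𝔤_NS(X₁ × X₂; ℝ) = dim_ℝ 𝔤_NS(X₁; ℝ) + dim_ℝ 𝔤_NS(X₂; ℝ)`** for `Hom`-orthogonal polarised tori of positive
dimension. [cite: LooijengaLunts1997, §3 (p. 14, standard reduction: 𝔤_NS(X) = 𝔤_NS(X₁^m₁) × ⋯ × 𝔤_NS(X_k^m_k))] -/
theorem finrank_neronSeveriLieAlgebra_prodPeriod :
    Module.finrank ℝ (neronSeveriLieAlgebra (prodPeriod Φ₁ Φ₂)) =
      Module.finrank ℝ (neronSeveriLieAlgebra Φ₁) + Module.finrank ℝ (neronSeveriLieAlgebra Φ₂) := by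
  have e : (neronSeveriLieAlgebra (prodPeriod Φ₁ Φ₂)) ≃ₗ[ℝ] (neronSeveriLieAlgebra Φ₁ × neronSeveriLieAlgebra Φ₂) :=
    (neronSeveriLieAlgebraProdEquiv hη₁ hη₂ hG₁ hG₂ h₁ h₂ h₁₂ h₂₁).toLinearEquiv
  rw [e.finrank_eq, Module.finrank_prod]

omit [FiniteDimensional ℂ E₁] [FiniteDimensional ℂ E₂] in
/-- **`𝔤_NS(X₁ × X₂; ℝ) ≅ 𝔤_NS(X₁; ℝ) × 𝔤_NS(X₂; ℝ)` for abelian varieties `X₁`, `X₂` of positive dimension with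
`Hom_ℚ(X₁, X₂) = 0 = Hom_ℚ(X₂, X₁)`** — the hypothesis-free existence form (Riemann forms, rational Gram matrices and inverse flat
maps chosen by `IsRiemannForm.exists_ratMatrix_latticeGram_isUnit`, `IsRiemannForm.exists_rinv`). [cite: LooijengaLunts1997, §3 (p. 14, standard reduction: 𝔤_NS(X) = 𝔤_NS(X₁^m₁) × ⋯ × 𝔤_NS(X_k^m_k))] -/
theorem IsAbelianVariety.nonempty_neronSeveriLieAlgebra_prodPeriod_equiv [FiniteDimensional ℂ E₁] [FiniteDimensional ℂ E₂]
    (hX₁ : IsAbelianVariety Φ₁) (hX₂ : IsAbelianVariety Φ₂) (h₁₂ : homRat Φ₁ Φ₂ = ⊥) (h₂₁ : homRat Φ₂ Φ₁ = ⊥) :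
    Nonempty (neronSeveriLieAlgebra (prodPeriod Φ₁ Φ₂) ≃ₗ⁅ℝ⁆ (neronSeveriLieAlgebra Φ₁ × neronSeveriLieAlgebra Φ₂)) := by
  obtain ⟨η₁, hη₁⟩ := hX₁
  obtain ⟨η₂, hη₂⟩ := hX₂
  obtain ⟨G₁, hG₁, -⟩ := hη₁.exists_ratMatrix_latticeGram_isUnit
  obtain ⟨G₂, hG₂, -⟩ := hη₂.exists_ratMatrix_latticeGram_isUnit
  obtain ⟨P₁, h₁⟩ := hη₁.exists_rinv Φ₁
  obtain ⟨P₂, h₂⟩ := hη₂.exists_rinv Φ₂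
  exact ⟨neronSeveriLieAlgebraProdEquiv hη₁ hη₂ hG₁ hG₂ h₁ h₂ h₁₂ h₂₁⟩

set_option synthInstance.maxHeartbeats 200000 in
set_option maxHeartbeats 800000 in
-- the additive / module instances on `↥(neronSeveriLieAlgebra (prodPeriod Φ₁ Φ₂))` are slow to find over `E₁ × E₂`
omit [FiniteDimensional ℂ E₁] [FiniteDimensional ℂ E₂] in
/-- **`dim_ℝ 𝔤_NS(X₁ × X₂; ℝ) = dim_ℝ 𝔤_NS(X₁; ℝ) + dim_ℝ 𝔤_NS(X₂; ℝ)`** for `Hom`-orthogonal abelian varieties of positive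
dimension (with row A1-56: `2ρ + dim_ℚ 𝔤_NS(X; ℚ)₀` is additive). [cite: LooijengaLunts1997, §3 (p. 14, standard reduction: 𝔤_NS(X) = 𝔤_NS(X₁^m₁) × ⋯ × 𝔤_NS(X_k^m_k))] [cite: HulekLaface2019PicardNumbers, Prop. 2.2 / Cor. 2.3] -/
theorem IsAbelianVariety.finrank_neronSeveriLieAlgebra_prodPeriod [FiniteDimensional ℂ E₁] [FiniteDimensional ℂ E₂]
    (hX₁ : IsAbelianVariety Φ₁) (hX₂ : IsAbelianVariety Φ₂) (h₁₂ : homRat Φ₁ Φ₂ = ⊥) (h₂₁ : homRat Φ₂ Φ₁ = ⊥) :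
    Module.finrank ℝ (neronSeveriLieAlgebra (prodPeriod Φ₁ Φ₂)) =
      Module.finrank ℝ (neronSeveriLieAlgebra Φ₁) + Module.finrank ℝ (neronSeveriLieAlgebra Φ₂) := by
  obtain ⟨e⟩ := hX₁.nonempty_neronSeveriLieAlgebra_prodPeriod_equiv hX₂ h₁₂ h₂₁
  have e' : (neronSeveriLieAlgebra (prodPeriod Φ₁ Φ₂)) ≃ₗ[ℝ] (neronSeveriLieAlgebra Φ₁ × neronSeveriLieAlgebra Φ₂) :=
    e.toLinearEquiv
  rw [e'.finrank_eq, Module.finrank_prod]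

end Torus

end ComplexTorus

end Literature.Geometry.Kaehler
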